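import Literature.NumberTheory.EllipticCurves.ZpExtensionCoeffSelmerStructure
import Literature.NumberTheory.EllipticCurves.ZpExtensionEisensteinDVRSetting
import Literature.NumberTheory.EllipticCurves.ZpExtensionEisensteinTwistFreeProofs
import Literature.NumberTheory.EllipticCurves.ZpExtensionEisensteinOrdinaryFiltration
import Literature.NumberTheory.EllipticCurves.ZpExtensionUnramifiedProofs
import Literature.NumberTheory.EllipticCurves.GoodReductionUnramifiedProofs
import Literature.NumberTheory.EllipticCurves.LambdaAdicSelmerDataToCoeffLimitH1
import Literature.NumberTheory.EllipticCurves.IwasawaAlgebraPseudoNullProofs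
import Literature.NumberTheory.GaloisCohomology.Howard2004.CoeffTowerKolyvaginSystems
import Literature.NumberTheory.GaloisCohomology.Howard2004.LevelDataCanonical
import Literature.NumberTheory.GaloisCohomology.Howard2004.FiniteSingularTameTower
import Literature.NumberTheory.GaloisCohomology.Howard2004.FiniteSingularNatural
import Literature.NumberTheory.GaloisCohomology.Howard2004.SemilinearRingChange
import Mathlib.LinearAlgebra.TensorProduct.RightExactness
import HarnessLib

/-!
# The `Λ`-adic Selmer triple `(𝐓, 𝓕_Λ, 𝓛)` of `E/K` (Howard 2004 §2.2–2.3 / Castella–Grossi–Lee–Skinner 2022 §3.4–4.1)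
# as a term of `Howard2004.CoeffTowerSetting` over `R = Λ`, on the SHAPIRO DIAGONAL
# `𝐓_j = E_K[p^{j+1}] ⊗ Λ/(ω_{j+1}, p^{j+1}) = Ind_{K_{j+1}/K} E_K[p^{j+1}]`
# (definitions with bodies + unfolding / bridge theorems; no named fact, no notation)

Topic `NumberTheory/EllipticCurves` (cell `pub/bsd-print-x9`, literature seat, TRANCHE 5 file A2; sequel of
`ZpExtensionCoeffSelmerStructure` (A1: `𝓕_Λ` level by level) and of seat x9-p2's `ZpExtensionCoeffAdicTower` /
`LambdaAdicSelmerDataToCoeffLimitH1` (the tower and the comparison `Φ : 𝔖 → lim_k H¹(K, 𝐓_k)`); the D1 road's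
`ZpExtensionEisensteinDVRSetting` is the model of the assembly, field by field).  This is the SOURCE setting `S_Λ` on
which the cite-only fact «CGLS 2022 Thm. 4.1.1: there is `κ^{Hg} ∈ 𝐊𝐒(𝐓, 𝓕_Λ, 𝓛_E)` with `κ₁^{Hg} ≠ 0`» is typed
(sequel `CastellaGrossiLeeSkinner2022/HeegnerPointKolyvaginSystem`), and the source of the x9-p1 LEAD's / x9-p2's
`CoeffTowerSetting.Hom` / `KolyvaginSystem.reindex` / `Hom.pushforward` into the Eisenstein specialisation.

PRINT.  Howard [Compositio 140 (2004), §2.2 Def. 2.2.3 = arXiv:1202.6340 Def. 3.2.3, p0016 L47–55]: «`𝐓 = lim←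
Ind_{K_n/K} T` … canonical isomorphism `𝐓 ≅ T ⊗ Λ`»; Def. 2.2.6 [p0016 L104–110]: `𝓕_Λ`; §2.3 [p0018 L65]: «Define
`𝓛 = 𝓛₁(𝐓)`»; Thm. 2.3.1: «There exists a Kolyvagin system `κ^{Hg} ∈ 𝐊𝐒(𝐓, 𝓕_Λ, 𝓛)` …»; Def. 1.2.3 / Rem. 1.2.4
[arXiv p. 7 L1–27]: Kolyvagin systems on the quotients `𝐓/I_n𝐓`, functorial in the coefficient ring; Def. 1.1.8
[arXiv p. 5 L144–149]: the finite–singular comparison maps.  CGLS [Invent. math. 227 (2022) §3.4, arXiv:2008.02571v2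
TeX L2083–2108]: «`𝐓 := M_E^∨(1) ≃ T_pE ⊗_{ℤ_p} Λ`, where the `G_K`-action on `Λ` is given by the inverse `Ψ⁻¹` of
the tautological character» (so consumers take `κ₀ := κ.unitTwist (-1)`, the twist of x9-p2's `Φ` and of the D1
target), `𝓕_Λ` ordinary at `w ∣ p` and `H¹(K_w, 𝐓)` at the other places of `Σ = {w ∣ pN∞}`; §3.1 [v1 p0014 L25–33]:
«a Selmer triple `(M, 𝓕, 𝓛)` … `𝓛 ⊂ 𝓛₀` with `𝓛 ∩ Σ(𝓕) = ∅`»; §3.2 [v1 p0015 L30–32]: «`𝓛_E := {ℓ ∈ 𝓛₀(T_pE) :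
a_ℓ ≡ ℓ + 1 ≡ 0 (mod p)}`» = Howard's `𝓛₁` [arXiv p0012 L133–139: «`I_ℓ` is generated by `a_ℓ` and `ℓ+1`»].

WHAT IS HERE
§1 (generic, `ZpExtension`): the Shapiro level rings `Λ/(ω_k, p^k)` (non-trivial, LOCAL, FINITE for `k ≥ 1`; the
residue character `[F] ↦ F(0) mod p` and the residual module structure on a `p`-torsion group (an `abbrev`, used with
`letI`); INSTANCES, all forced by the binders of lit's `CoeffTowerSetting` / `DualityDatum` (`[∀ k, TopologicalSpace /
DiscreteTopology / IsLocalRing (Rk k)]`, `[∀ k, Module (Rk k) (N k)]`, `[∀ k, IsScalarTower R (Rk k) (N k)]`): the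
DISCRETE topology on `Λ/(ω_k, p^k)` (two, verbatim the D1 road's `IwasawaAlgebra.EisensteinCoeff.instTopologicalSpace /
instDiscreteTopology`; `Λ` itself carries no topology instance, so no diamond), `IsLocalRing (Λ/(ω_{j+1}, p^{j+1}))`
(Prop), the scalar tower `Λ → Λ/I_k → End(M_k ⊗ Λ/I_k)` on x9-p2's `CoeffLevel` (Prop), and in §2 the `Λ/(ω_{j+1},
p^{j+1})`-module structure / scalar tower of the SHIFTED level family (x9-p2's `CoeffLevel.instModule` restated so that
instance resolution finds it under the binder `j`; definitionally the generic instance)); finiteness of the levels; the EXACTNESS of x9-p2's `coeffAdicTower` in the currency of the level rings — `ker(𝐓_{k+1} ↠ 𝐓_k) = Ī_k 𝐓_{k+1}`,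
`Ī_k = ker(Λ/I_{k+1} ↠ Λ/I_k)`, from right exactness of `⊗` (`TensorProduct.map_ker`) — packaged as lit's
`IsBaseChangeBy` (`isBaseChangeBy_red_coeffAdicTower`); whence the reductions of the CANONICAL Kolyvagin quotients
`𝐓_{k+1}/I_n → 𝐓_k/I_n` (`coeffLevelQuotRed`, Mathlib `Submodule.mapQ`, `Λ`-linear; `rq_comp` by `rfl`) and of their
singular quotients (`coeffLevelQuotRedSingular` = lit's `singularQuotientMap`); the shift `OrdinaryFiltration.succ`.
§2 (the curve, `WeierstrassCurve`): the shifted Shapiro tower `shapiroTower` (x9-p2's `coeffAdicTower` on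
`E_K[p^{j+1}]`, `(ω_{j+1}, p^{j+1})`; `shapiroTower_ρ`: its level `j` IS Shapiro level `j+1` of the tower of x9-p2's
`toShapiroLimitH1`, by `rfl` — the shift is forced by `[∀ k, IsLocalRing (Rk k)]`: level `0` would be `Λ/(ω_0, 1) = 0`),
free (`E[p^k] ≅ (ℤ/p^k)²`) finite levels, unramified at the good places `v ∤ p`; the level triples `(𝐓_j, 𝓕_Λ, 𝓛)`
(A1's `coeffSelmerTriple` with the curve's `ordinaryFiltrationAt`; parameters `S ⊇ {v ∣ p}` finite with good reduction
off `S`, and `𝓛 ⊆ 𝓛₀(𝐓)` disjoint from `S` — the fact file takes `S = {v ∣ pN}`, `𝓛 = 𝓛₁(𝐓) ∖ S`); the residual data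
`T̄ = E_K[p]`, `θ = τ_*`; `Φ'` = x9-p2's `Φ` read on the shifted tower (`toShapiroSuccLimitH1`, `Λ`-linear);
**`WeierstrassCurve.shapiroSetting`** — the assembly, with (as in the D1 road's `eisensteinDVRSetting`) the slots that
`CoeffTowerSetting.KolyvaginSystem` does not read left as PARAMETERS: `cd`, `jbar`, the residual presentations `πbar`,
the H.4 pairing data `D`, and the finite–singular maps `fs` (`shapiroSettingTame`: `fs :=` lit g32's guarded tame slots
`tameSlotOn π _ P hP` for tame pins `π` and a guard `P` — `FsAdmissible` when the guard contains the level pairs,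
`FsNatural` always, both THEOREMS here; a morphism of settings needs the SAME `π` and `P` on both sides, lit's
`tameSlotOn_natural_cohomologyMap`, which is why they are parameters); unfolding lemmas; `kolyvaginSystemCongr`
(a Kolyvagin system for one choice of `(cd, πbar, D)` is one for any other: these slots are not read); `LargePrimes`
from `𝓛₁(𝐓) ⊆ 𝓛`.
CONSUMER PREAMBLE: a declaration mentioning `W.shapiroSetting K p κ₀ …` puts the residual module structures in scope
with `letI := W.shapiroResidueModule K p` (the other instance terms of the D1 preamble are instances here).
NOT here: the fact (sequel); the `Hom` into the Eisenstein specialisation (x9-p2 / x9-p1 LEAD); H.0–H.5 for `S_Λ` (not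
needed: the source of a push-forward carries no hypotheses); Howard's canonical `e_Λ` (Prop. 2.2.4).  BSD is not
proved by any of this.

References: [Howard2004HeegnerKolyvagin] §1.1 Def. 1.1.8, §1.2 Def. 1.2.1–1.2.3, Rem. 1.2.4, §1.3, §1.6, §2.2
Def. 2.2.3–2.2.6, §2.3 (arXiv:1202.6340 pp. 5–7, 11–12, p0016, p0018); [CastellaGrossiLeeSkinner2022] §3.1–§3.4,
Thm. 4.1.1 (arXiv:2008.02571v2 TeX L2083–2108, L2203–2206); [Washington1997] §7.1, §13.2; [SilvermanAEC2009] III.6.4,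
VII.4.1; [BourbakiAlgebre1a3] II §3 no. 6 Prop. 6; [SerreGaloisCohomology1997] I §2, II §1.
-/

set_option autoImplicit false

noncomputable section

universe u

open Function NumberField IsDedekindDomain Field IsLocalRing
open scoped NumberField ContRepresentation TensorProduct Classical

/-! ## §1 Generic layer: the Shapiro level rings; exactness and Kolyvagin quotients of the `Λ`-adic tower -/

namespace Literature.NumberTheory.EllipticCurves.ZpExtension

open Literature.NumberTheory.GaloisRepresentations
open Literature.NumberTheory.GaloisRepresentations.DiscreteGaloisModule
open Literature.NumberTheory.GaloisCohomology.Howard2004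

section ShapiroRings

variable (p : ℕ) [hp : Fact p.Prime]

/-- The residue map `Λ → ℤ_p → ℤ/p`, `F ↦ F(0) mod p`, kills `(ω_k, p^k)` for `k ≥ 1` (`ω_k(0) = 1^{p^k} − 1 = 0`).
[cite: Washington1997, §7.1 (Λ/(p, T) = 𝔽_p) and §13.2 (ω_n)] -/
theorem shapiroIdeal_le_ker_residue {k : ℕ} (hk : 1 ≤ k) :
    shapiroIdeal p k ≤ RingHom.ker ((PadicInt.toZMod (p := p)).comp (PowerSeries.constantCoeff (R := ℤ_[p]))) := by
  refine sup_le ?_ ?_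
  · rw [Ideal.span_le, Set.singleton_subset_iff, SetLike.mem_coe, RingHom.mem_ker, map_sub, map_pow, map_add,
      map_one, RingHom.comp_apply, PowerSeries.constantCoeff_X, map_zero, add_zero, one_pow, sub_self]
  · rw [Ideal.span_le, Set.singleton_subset_iff, SetLike.mem_coe, RingHom.mem_ker, map_pow, map_natCast,
      ZMod.natCast_self, zero_pow (by omega)]

/-- `(ω_k, p^k) ≠ Λ` for `k ≥ 1`. [cite: Washington1997, §13.2] -/
theorem shapiroIdeal_ne_top {k : ℕ} (hk : 1 ≤ k) : shapiroIdeal p k ≠ ⊤ := fun h ↦ by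
  have h1 : (1 : IwasawaAlgebra p) ∈ shapiroIdeal p k := h ▸ Submodule.mem_top
  have h2 := shapiroIdeal_le_ker_residue p hk h1
  rw [RingHom.mem_ker, map_one] at h2
  exact one_ne_zero h2

/-- `Λ/(ω_k, p^k)` is non-trivial for `k ≥ 1`. [cite: Washington1997, §13.2 (Λ/(ω_n, p^k) = ℤ/p^k[Γ/Γ_n])] -/
theorem nontrivial_quotient_shapiroIdeal {k : ℕ} (hk : 1 ≤ k) : Nontrivial (IwasawaAlgebra p ⧸ shapiroIdeal p k) :=
  Ideal.Quotient.nontrivial_iff.mpr (shapiroIdeal_ne_top p hk)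

/-- **`Λ/(ω_k, p^k)` is a local ring** for `k ≥ 1` (a non-trivial quotient of the local ring `Λ`): Howard's finite level
coefficient rings are local. [cite: Howard2004HeegnerKolyvagin, §1.6 (arXiv p. 11, L13–20: the level rings R/𝔪^{e_k})] [cite: Washington1997, §13.2] -/
theorem isLocalRing_quotient_shapiroIdeal {k : ℕ} (hk : 1 ≤ k) : IsLocalRing (IwasawaAlgebra p ⧸ shapiroIdeal p k) :=
  haveI := nontrivial_quotient_shapiroIdeal p hk
  IsLocalRing.of_surjective' (Ideal.Quotient.mk (shapiroIdeal p k)) Ideal.Quotient.mk_surjective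

/-- The level rings `Λ/(ω_{j+1}, p^{j+1})` of the shifted Shapiro tower are local (instance: the binder
`[∀ k, IsLocalRing (Rk k)]` of `CoeffTowerSetting`). [cite: Howard2004HeegnerKolyvagin, §1.6 (arXiv p. 11, L13–20)] -/
instance isLocalRing_quotient_shapiroIdeal_succ (j : ℕ) : IsLocalRing (IwasawaAlgebra p ⧸ shapiroIdeal p (j + 1)) :=
  isLocalRing_quotient_shapiroIdeal p j.succ_pos

/-- **`Λ/(ω_k, p^k)` is finite** (a quotient of the finite ring `Λ/𝔪^{k p^k + k}`, x9-p2's `maximalIdeal_pow_le_shapiroIdeal`).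
[cite: Washington1997, §13.2 (Λ/(ω_n, p^k) = ℤ/p^k[Γ/Γ_n])] -/
theorem finite_quotient_shapiroIdeal (k : ℕ) : Finite (IwasawaAlgebra p ⧸ shapiroIdeal p k) :=
  haveI := IwasawaAlgebra.finite_quotient_maximalIdeal_pow p (k * p ^ k + k)
  Finite.of_surjective (Ideal.Quotient.factor (maximalIdeal_pow_le_shapiroIdeal p k))
    (Ideal.Quotient.factor_surjective (maximalIdeal_pow_le_shapiroIdeal p k))

/-- `p^k = 0` in `Λ/(ω_k, p^k)`. [cite: Washington1997, §13.2] -/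
theorem natCast_pow_eq_zero_quotient_shapiroIdeal (k : ℕ) :
    ((p ^ k : ℕ) : IwasawaAlgebra p ⧸ shapiroIdeal p k) = 0 := by
  rw [← map_natCast (Ideal.Quotient.mk (shapiroIdeal p k)), Ideal.Quotient.eq_zero_iff_mem, Nat.cast_pow]
  exact natCast_pow_mem_shapiroIdeal p k

/-- **The DISCRETE topology on the finite level ring `Λ/(ω_k, p^k)`** (required by the signatures of lit's
`CoeffTowerSetting` / `DualityDatum`; `Λ` carries no topology instance, so no diamond) — verbatim the D1 road's
`IwasawaAlgebra.EisensteinCoeff.instTopologicalSpace`. [cite: Howard2004HeegnerKolyvagin, §1.3 H.4 (R(1) as a discrete G_K-module) and §1.6] -/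
instance instTopologicalSpaceQuotientShapiroIdeal (k : ℕ) : TopologicalSpace (IwasawaAlgebra p ⧸ shapiroIdeal p k) := ⊥

/-- The topology on `Λ/(ω_k, p^k)` is discrete by definition. [cite: Howard2004HeegnerKolyvagin, §1.3 H.4 and §1.6] -/
instance instDiscreteTopologyQuotientShapiroIdeal (k : ℕ) : DiscreteTopology (IwasawaAlgebra p ⧸ shapiroIdeal p k) :=
  ⟨rfl⟩

/-- **The residue character `Λ/(ω_k, p^k) → 𝔽_p`, `[F] ↦ F(0) mod p`** (`k ≥ 1`): reduction modulo the maximal ideal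
`(p, T) = (p, γ − 1)`, read on the finite level. [cite: Howard2004HeegnerKolyvagin, proof of Prop. 2.1.3 (arXiv Prop. 3.1.3: Λ/(p, γ − 1))] [cite: Washington1997, §7.1] -/
def shapiroResidueChar {k : ℕ} (hk : 1 ≤ k) : (IwasawaAlgebra p ⧸ shapiroIdeal p k) →+* ZMod p :=
  Ideal.Quotient.lift _ ((PadicInt.toZMod (p := p)).comp (PowerSeries.constantCoeff (R := ℤ_[p])))
    fun _ ha ↦ shapiroIdeal_le_ker_residue p hk ha

/-- `ε [F] = F(0) mod p`. [cite: Howard2004HeegnerKolyvagin, proof of Prop. 2.1.3] -/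
@[simp]
theorem shapiroResidueChar_mk {k : ℕ} (hk : 1 ≤ k) (F : IwasawaAlgebra p) :
    shapiroResidueChar p hk (Ideal.Quotient.mk _ F) = PadicInt.toZMod (PowerSeries.constantCoeff F) :=
  rfl

variable {p} in
/-- **The residual `Λ/(ω_k, p^k)`-module structure on a `p`-torsion group `N`** through the residue character
(`[F] • P = F(0) · P`; `N = E_K[p] = T̄`) — the structure in which `T̄ = 𝐓/𝔪𝐓` is an object of `Mod_{R_j}`.  A reducible
definition, NOT an instance (use with `letI`). [cite: Howard2004HeegnerKolyvagin, §1.3 H.1 (T̄ = T/𝔪T) and proof of Prop. 2.1.3] -/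
abbrev shapiroResidueModule {k : ℕ} (hk : 1 ≤ k) {N : Type*} [AddCommGroup N] (hN : ∀ n : N, p • n = 0) :
    Module (IwasawaAlgebra p ⧸ shapiroIdeal p k) N :=
  letI : Module (ZMod p) N := AddCommGroup.zmodModule hN
  Module.compHom N (shapiroResidueChar p hk)

/-- Under `shapiroResidueModule`: `c • n = (ε c).val • n`. [cite: Howard2004HeegnerKolyvagin, proof of Prop. 2.1.3] -/
theorem shapiroResidueModule_smul {k : ℕ} (hk : 1 ≤ k) {N : Type*} [AddCommGroup N]
    (hN : ∀ n : N, p • n = 0) (c : IwasawaAlgebra p ⧸ shapiroIdeal p k) (n : N) :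
    (letI := shapiroResidueModule hk hN; c • n) = (shapiroResidueChar p hk c).val • n := by
  letI : Module (ZMod p) N := AddCommGroup.zmodModule hN
  change (shapiroResidueChar p hk c) • n = _
  conv_lhs => rw [← ZMod.natCast_zmod_val (shapiroResidueChar p hk c)]
  exact Nat.cast_smul_eq_nsmul _ _ _

end ShapiroRings

/-! ### The level carriers: scalar tower, finiteness -/

section Levels

variable {p : ℕ} [hp : Fact p.Prime]

/-- **The scalar tower `Λ → Λ/I_k → End(M_k ⊗ Λ/I_k)`**: x9-p2's `Λ`-action on `CoeffLevel` IS the `Λ/I_k`-action through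
`Λ ↠ Λ/I_k` (`CoeffLevel.iwasawa_smul_def`, `rfl`); the binder `[∀ k, IsScalarTower R (Rk k) (N k)]` of
`CoeffTowerSetting`. [cite: Howard2004HeegnerKolyvagin, §1.6 (arXiv p. 11, L33–38) and §2.2 (𝐓 = T ⊗ Λ)] -/
instance CoeffLevel.instIsScalarTowerIwasawa (I : ℕ → Ideal (IwasawaAlgebra p)) (M : ℕ → Type)
    [∀ k, AddCommGroup (M k)] (k : ℕ) :
    IsScalarTower (IwasawaAlgebra p) (IwasawaAlgebra p ⧸ I k) (CoeffLevel p I M k) :=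
  ⟨fun a b x ↦ by
    obtain ⟨b, rfl⟩ := Ideal.Quotient.mk_surjective b
    change (Ideal.Quotient.mk (I k) (a * b)) • x = Ideal.Quotient.mk (I k) a • (Ideal.Quotient.mk (I k) b • x)
    rw [map_mul, mul_smul]⟩

/-- **`A ⊗ M` is finite for a finite commutative ring `A` and a finite abelian group `M`** (a finite module over the
finite ring `A`). [cite: BourbakiAlgebre1a3, II §3 no. 6] [cite: Howard2004HeegnerKolyvagin, §2.2 (the finite quotients 𝐓/I𝐓)] -/
theorem finite_quotTwisted (A : Type) [CommRing A] [Finite A] (M : Type) [AddCommGroup M] [Finite M] :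
    Finite (QuotTwisted A M) := by
  haveI : Module.Finite ℤ M := Module.Finite.of_finite
  change Finite (A ⊗[ℤ] M)
  exact Module.finite_of_finite A

/-- The levels `M_k ⊗ Λ/I_k` of a `Λ`-adic tower with finite `M_k` and `I_k ⊇ 𝔪^{e_k}` are finite.
[cite: Howard2004HeegnerKolyvagin, §2.2 (𝐓/I𝐓 is finite for I open)] -/
theorem finite_coeffLevel (I : ℕ → Ideal (IwasawaAlgebra p)) (e : ℕ → ℕ)
    (he : ∀ k, maximalIdeal (IwasawaAlgebra p) ^ e k ≤ I k) (M : ℕ → Type) [∀ k, AddCommGroup (M k)]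
    [∀ k, Finite (M k)] (k : ℕ) : Finite (CoeffLevel p I M k) := by
  haveI := IwasawaAlgebra.finite_quotient_maximalIdeal_pow p (e k)
  haveI : Finite (IwasawaAlgebra p ⧸ I k) :=
    Finite.of_surjective (Ideal.Quotient.factor (he k)) (Ideal.Quotient.factor_surjective (he k))
  exact finite_quotTwisted (IwasawaAlgebra p ⧸ I k) (M k)

end Levels

/-! ### Exactness of the coefficient change `M ⊗ A → M′ ⊗ A′` (right exactness of `⊗`) -/

section Exact

/-- **Kernel of a coefficient change.**  For `φ : A ↠ A′` and `f : M ↠ M′` onto with `ker f ⊆ n M` for an integer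
`n` with `φ n = 0`, every `x ∈ A ⊗ M` killed by `φ ⊗ f` lies in `(ker φ) · (A ⊗ M)`: by right exactness
`ker(φ ⊗ f) = (A ⊗ ker f) + (ker φ ⊗ M)` (Mathlib `TensorProduct.map_ker`), and `a ⊗ n y = (n a) ⊗ y` with `n a ∈ ker φ`.
(Stated on Mathlib's `A ⊗[ℤ] M`; x9-p2's `QuotTwisted A M` / `CoeffLevel` levels ARE this type.)
[cite: BourbakiAlgebre1a3, II §3 no. 6 Prop. 6] [cite: Howard2004HeegnerKolyvagin, §1.6 (arXiv p. 12, L29–55: the exact tower T/𝔪^{e_k} T)] -/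
theorem tensor_mem_ker_smul_top_of_map_eq_zero {A A' : Type} [CommRing A] [CommRing A']
    (φ : A →+* A') (hφ : Function.Surjective φ) {M M' : Type u} [AddCommGroup M] [AddCommGroup M']
    (f : M →ₗ[ℤ] M') (hf : Function.Surjective f) (n : ℤ) (hn : (n : A) ∈ RingHom.ker φ)
    (hkf : ∀ x : M, f x = 0 → ∃ y : M, x = n • y) (x : A ⊗[ℤ] M)
    (hx : TensorProduct.map φ.toAddMonoidHom.toIntLinearMap f x = 0) :
    x ∈ (RingHom.ker φ • (⊤ : Submodule A (A ⊗[ℤ] M)) : Submodule A (A ⊗[ℤ] M)) := by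
  have hx' : x ∈ LinearMap.ker (TensorProduct.map φ.toAddMonoidHom.toIntLinearMap f) := hx
  rw [TensorProduct.map_ker (LinearMap.exact_subtype_ker_map φ.toAddMonoidHom.toIntLinearMap) hφ
    (LinearMap.exact_subtype_ker_map f) hf, Submodule.mem_sup] at hx'
  obtain ⟨y, hy, z, hz, rfl⟩ := hx'
  clear hx
  refine Submodule.add_mem _ ?_ ?_
  · -- `y ∈ A ⊗ ker f ⊆ (ker φ) · (A ⊗ M)`
    obtain ⟨w, rfl⟩ := LinearMap.mem_range.mp hy
    induction w using TensorProduct.induction_on with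
    | zero => rw [map_zero]; exact Submodule.zero_mem _
    | tmul a m =>
      obtain ⟨y', hy'⟩ := hkf m m.2
      rw [LinearMap.lTensor_tmul, Submodule.subtype_apply, hy', TensorProduct.tmul_smul, TensorProduct.smul_tmul',
        zsmul_eq_mul, ← smul_eq_mul, ← TensorProduct.smul_tmul']
      exact Submodule.smul_mem_smul hn Submodule.mem_top
    | add w₁ w₂ h₁ h₂ =>
      rw [map_add]
      exact Submodule.add_mem _ (h₁ (LinearMap.mem_range_self _ _)) (h₂ (LinearMap.mem_range_self _ _))
  · -- `z ∈ ker φ ⊗ M ⊆ (ker φ) · (A ⊗ M)`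
    obtain ⟨w, rfl⟩ := LinearMap.mem_range.mp hz
    induction w using TensorProduct.induction_on with
    | zero => rw [map_zero]; exact Submodule.zero_mem _
    | tmul c m =>
      rw [LinearMap.rTensor_tmul, Submodule.subtype_apply]
      have e1 : ((c : A) ⊗ₜ[ℤ] m : A ⊗[ℤ] M) = (c : A) • ((1 : A) ⊗ₜ[ℤ] m : A ⊗[ℤ] M) := by
        rw [TensorProduct.smul_tmul', smul_eq_mul, mul_one]
      rw [e1]
      exact Submodule.smul_mem_smul c.2 Submodule.mem_top
    | add w₁ w₂ h₁ h₂ =>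
      rw [map_add]
      exact Submodule.add_mem _ (h₁ (LinearMap.mem_range_self _ _)) (h₂ (LinearMap.mem_range_self _ _))

end Exact

/-! ### The `Λ`-adic tower is exact in the currency of its level rings; its canonical Kolyvagin quotients -/

section Tower

variable {K : Type} [Field K] [NumberField K] {p : ℕ} [hp : Fact p.Prime] (κ : ZpExtension K p)
  {M : ℕ → Type} [∀ k, AddCommGroup (M k)] [∀ k, TopologicalSpace (M k)] [∀ k, DiscreteTopology (M k)]
  (ρ : ∀ k, DiscreteGaloisModule K (M k))
  (t : ∀ k, (ρ (k + 1)).toContRepresentation →ⁱL (ρ k).toContRepresentation)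
  (I : ℕ → Ideal (IwasawaAlgebra p)) (hI : ∀ k, I (k + 1) ≤ I k)
  (J : ℕ → ℕ) (hJ : ∀ k, ((1 + PowerSeries.X : IwasawaAlgebra p) ^ (p ^ J k) - 1) ∈ I k)
  (e : ℕ → ℕ) (he : ∀ k, maximalIdeal (IwasawaAlgebra p) ^ e k ≤ I k)
  (ht : ∀ k, Function.Surjective (t k))

omit [NumberField K] in
/-- `Γ_K` acts `Λ/I_k`-linearly on the level `M_k ⊗ (Λ/I_k)(χ)` (x9-p2's `coeffTwist_apply_smul`) — «`𝐓_k ∈ Mod_{R_k, K}`»,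
the `IsScalarLinear` input of `LevelData.canonical` / `modIdeal` over the level ring.
[cite: Howard2004HeegnerKolyvagin, §1.6 (arXiv p. 11, L33–38) and §2.2] -/
theorem isScalarLinear_coeffAdicTower_coeff (k : ℕ) :
    ((κ.coeffAdicTower ρ t I hI J hJ e he ht).ρ k).IsScalarLinear (IwasawaAlgebra p ⧸ I k) :=
  fun σ c x ↦ κ.coeffTwist_apply_smul (ρ k) (mk_one_add_X_pow_prime_pow_eq_one (I k) (hJ k)) σ c x

omit [NumberField K] in
/-- An element of `ker κ` acting trivially on `M` acts trivially on `M ⊗ A(χ)` (pure tensors: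
`coeffTwist_apply_tmul_of_mem_kerSubgroup`). [cite: Howard2004HeegnerKolyvagin, §2.2] [cite: Washington1997, Prop. 13.2] -/
theorem coeffTwist_apply_eq_self_of_mem_kerSubgroup {N : Type} [AddCommGroup N] [TopologicalSpace N]
    [DiscreteTopology N] (ρN : DiscreteGaloisModule K N) {A : Type} [CommRing A] {u : A} {j : ℕ}
    (hu : u ^ (p ^ j) = 1) {σ : absoluteGaloisGroup K} (hσ : σ ∈ κ.kerSubgroup) (hρ : ∀ a : N, ρN σ a = a)
    (x : CoeffExtension ℤ A N) : κ.coeffTwist ρN u j hu σ x = x := by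
  induction x using CoeffExtension.induction_on with
  | zero => exact map_zero _
  | tmul c a => rw [κ.coeffTwist_apply_tmul_of_mem_kerSubgroup ρN hu hσ, hρ]
  | add x y hx hy => rw [map_add, hx, hy]

omit [NumberField K] in
/-- **The tower is EXACT in the currency of the level rings**: `red_k x = 0 ⟹ x ∈ Ī_k • 𝐓_{k+1}`,
`Ī_k = ker(Λ/I_{k+1} ↠ Λ/I_k)`, when `ker t_k = n_k M_{k+1}` for an integer `n_k ∈ I_k` (for `E[p^•]`: `n_k = p^k`).
[cite: Howard2004HeegnerKolyvagin, §1.6 (arXiv p. 12, L29–55: the exact tower) and Rem. 1.2.4] [cite: BourbakiAlgebre1a3, II §3 no. 6 Prop. 6] -/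
theorem red_coeffAdicTower_ker_le (k : ℕ) (n : ℤ) (hn : (n : IwasawaAlgebra p) ∈ I k)
    (hkt : ∀ x : M (k + 1), t k x = 0 → ∃ y : M (k + 1), x = n • y) (x : CoeffLevel p I M (k + 1))
    (hx : (κ.coeffAdicTower ρ t I hI J hJ e he ht).red k x = 0) :
    x ∈ (RingHom.ker (Ideal.Quotient.factor (hI k)) •
        (⊤ : Submodule (IwasawaAlgebra p ⧸ I (k + 1)) (CoeffLevel p I M (k + 1))) :
        Submodule (IwasawaAlgebra p ⧸ I (k + 1)) (CoeffLevel p I M (k + 1))) := by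
  have hn' : ((n : IwasawaAlgebra p ⧸ I (k + 1))) ∈ RingHom.ker (Ideal.Quotient.factor (hI k)) := by
    rw [RingHom.mem_ker, map_intCast, ← map_intCast (Ideal.Quotient.mk (I k)), Ideal.Quotient.eq_zero_iff_mem]
    exact hn
  exact tensor_mem_ker_smul_top_of_map_eq_zero (Ideal.Quotient.factor (hI k))
    (Ideal.Quotient.factor_surjective (hI k)) (t k).toContinuousLinearMap.toLinearMap (ht k) n hn'
    (fun y hy ↦ hkt y hy) x hx

omit [NumberField K] in
/-- **The reduction `𝐓_{k+1} ↠ 𝐓_k` is a BASE CHANGE along `Λ/I_{k+1} ↠ Λ/I_k`** (lit's `IsBaseChangeBy`: onto, semilinear,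
equivariant, kernel `Ī_k 𝐓_{k+1}`) — Howard's Rem. 1.2.4 reading of the tower transitions.
[cite: Howard2004HeegnerKolyvagin, Rem. 1.2.4 and §1.6 (arXiv p. 7 L13–27, p. 12 L29–55)] -/
theorem isBaseChangeBy_red_coeffAdicTower (k : ℕ) (n : ℤ) (hn : (n : IwasawaAlgebra p) ∈ I k)
    (hkt : ∀ x : M (k + 1), t k x = 0 → ∃ y : M (k + 1), x = n • y) :
    IsBaseChangeBy ((κ.coeffAdicTower ρ t I hI J hJ e he ht).ρ (k + 1)) (Ideal.Quotient.factor (hI k))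
      ((κ.coeffAdicTower ρ t I hI J hJ e he ht).ρ k) ((κ.coeffAdicTower ρ t I hI J hJ e he ht).red k).toAddMonoidHom where
  ringHom_surjective := Ideal.Quotient.factor_surjective (hI k)
  surjective := (κ.coeffAdicTower ρ t I hI J hJ e he ht).red_surjective k
  map_smul c x := κ.coeffTwistReduce_smul (mk_one_add_X_pow_prime_pow_eq_one (I (k + 1)) (hJ (k + 1)))
    (mk_one_add_X_pow_prime_pow_eq_one (I k) (hJ k)) (Ideal.Quotient.factor (hI k)) (factor_coeffLevelUnit I hI k)
    (t k) c x
  ker_le x hx := κ.red_coeffAdicTower_ker_le ρ t I hI J hJ e he ht k n hn hkt x hx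
  equivariant σ x := (κ.coeffAdicTower ρ t I hI J hJ e he ht).red_equivariant k σ x

/-- **The canonical Kolyvagin quotient `𝐓_k / I_n 𝐓_k`** of the level `k` as a discrete `Γ_K`-module (`modIdeal`, the action
of `LevelData.canonical`), `I_n = I_n(Λ/I_k, 𝐓_k)`.  An `abbrev`.
[cite: Howard2004HeegnerKolyvagin, Def. 1.2.1 and Def. 1.2.3 (arXiv p. 6 L73–75, p. 7 L1–6)] -/
abbrev coeffLevelQuot (k : ℕ) (n : Finset (HeightOneSpectrum (𝓞 K))) :
    DiscreteGaloisModule K (LevelData.QuotCarrier (IwasawaAlgebra p ⧸ I k)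
      ((κ.coeffAdicTower ρ t I hI J hJ e he ht).ρ k) n) :=
  modIdeal ((κ.coeffAdicTower ρ t I hI J hJ e he ht).ρ k) (κ.isScalarLinear_coeffAdicTower_coeff ρ t I hI J hJ e he ht k)
    (levelIdeal (R := IwasawaAlgebra p ⧸ I k) ((κ.coeffAdicTower ρ t I hI J hJ e he ht).ρ k) n)

/-- The canonical Kolyvagin quotients of finite levels are finite. [cite: Howard2004HeegnerKolyvagin, Def. 1.2.3 (arXiv p. 7, L1–6)] -/
theorem finite_coeffLevelQuotCarrier [∀ k, Finite (M k)] (k : ℕ) (n : Finset (HeightOneSpectrum (𝓞 K))) :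
    Finite (LevelData.QuotCarrier (IwasawaAlgebra p ⧸ I k) ((κ.coeffAdicTower ρ t I hI J hJ e he ht).ρ k) n) := by
  haveI := finite_coeffLevel (p := p) I e he M k
  exact Finite.of_surjective (Submodule.mkQ _) (Submodule.mkQ_surjective _)

variable (n₀ : ℕ → ℤ) (hn₀ : ∀ k, (n₀ k : IwasawaAlgebra p) ∈ I k)
  (hkt : ∀ k (x : M (k + 1)), t k x = 0 → ∃ y : M (k + 1), x = n₀ k • y)

/-- **The reduction `𝐓_{k+1}/I_n 𝐓_{k+1} → 𝐓_k/I_n 𝐓_k` of the CANONICAL Kolyvagin quotients**, `Λ`-linear (Mathlib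
`Submodule.mapQ` through `Submodule.Quotient.restrictScalarsEquiv`; well defined by lit's
`IsBaseChangeBy.mapsTo_levelIdeal_smul_top`: `red(I_n 𝐓_{k+1}) ⊆ I_n 𝐓_k`) — the field `rq` of `CoeffTowerSetting`.
[cite: Howard2004HeegnerKolyvagin, §1.6 (arXiv p. 11, L49–50) and Def. 1.2.3, Rem. 1.2.4] -/
def coeffLevelQuotRed (k : ℕ) (n : Finset (HeightOneSpectrum (𝓞 K))) :
    LevelData.QuotCarrier (IwasawaAlgebra p ⧸ I (k + 1)) ((κ.coeffAdicTower ρ t I hI J hJ e he ht).ρ (k + 1)) n →ₗ[IwasawaAlgebra p]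
      LevelData.QuotCarrier (IwasawaAlgebra p ⧸ I k) ((κ.coeffAdicTower ρ t I hI J hJ e he ht).ρ k) n :=
  (Submodule.Quotient.restrictScalarsEquiv (IwasawaAlgebra p) _).toLinearMap ∘ₗ
    Submodule.mapQ _ _ ((κ.coeffAdicTower ρ t I hI J hJ e he ht).red k)
      (fun x hx ↦ (κ.isBaseChangeBy_red_coeffAdicTower ρ t I hI J hJ e he ht k (n₀ k) (hn₀ k) (hkt k)).mapsTo_levelIdeal_smul_top
        n x hx) ∘ₗ
    (Submodule.Quotient.restrictScalarsEquiv (IwasawaAlgebra p)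
      ((levelIdeal (R := IwasawaAlgebra p ⧸ I (k + 1)) ((κ.coeffAdicTower ρ t I hI J hJ e he ht).ρ (k + 1)) n) •
        (⊤ : Submodule (IwasawaAlgebra p ⧸ I (k + 1)) (CoeffLevel p I M (k + 1))))).symm.toLinearMap

/-- **`rq ∘ π_{k+1} = π_k ∘ red`** (the field `rq_comp`): the reduction of the class of `x` is the class of `red x`.
[cite: Howard2004HeegnerKolyvagin, §1.6 (arXiv p. 11, L49–50)] -/
@[simp]
theorem coeffLevelQuotRed_mk (k : ℕ) (n : Finset (HeightOneSpectrum (𝓞 K))) (x : CoeffLevel p I M (k + 1)) :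
    κ.coeffLevelQuotRed ρ t I hI J hJ e he ht n₀ hn₀ hkt k n (Submodule.Quotient.mk x) =
      Submodule.Quotient.mk ((κ.coeffAdicTower ρ t I hI J hJ e he ht).red k x) :=
  rfl

/-- The reduction of the canonical Kolyvagin quotients is `Γ_K`-equivariant (the field `rq_equivariant`).
[cite: Howard2004HeegnerKolyvagin, §1.6 (arXiv p. 11, L49–50) and Def. 1.1.3] -/
theorem coeffLevelQuotRed_equivariant (k : ℕ) (n : Finset (HeightOneSpectrum (𝓞 K))) (g : absoluteGaloisGroup K)
    (y : LevelData.QuotCarrier (IwasawaAlgebra p ⧸ I (k + 1)) ((κ.coeffAdicTower ρ t I hI J hJ e he ht).ρ (k + 1)) n) :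
    κ.coeffLevelQuotRed ρ t I hI J hJ e he ht n₀ hn₀ hkt k n (κ.coeffLevelQuot ρ t I hI J hJ e he ht (k + 1) n g y) =
      κ.coeffLevelQuot ρ t I hI J hJ e he ht k n g (κ.coeffLevelQuotRed ρ t I hI J hJ e he ht n₀ hn₀ hkt k n y) := by
  induction y using Submodule.Quotient.induction_on with
  | _ x =>
    rw [modIdeal_apply_mk, coeffLevelQuotRed_mk, coeffLevelQuotRed_mk, modIdeal_apply_mk,
      (κ.coeffAdicTower ρ t I hI J hJ e he ht).red_equivariant k g x]

/-- **The reduction on SINGULAR QUOTIENTS** `H¹_s(K_v, 𝐓_{k+1}/I_n) → H¹_s(K_v, 𝐓_k/I_n)` along `rq` (lit's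
`singularQuotientMap`) — the field `fsQ` of `CoeffTowerSetting` (so `fsQ_spec` holds by `rfl`, `singularQuotientMap_singularMap`).
[cite: Howard2004HeegnerKolyvagin, Def. 1.2.3 display (ks relations) and §1.6 (arXiv p. 6 L126–140, p. 11 L49–50)] -/
def coeffLevelQuotRedSingular (k : ℕ) (n : Finset (HeightOneSpectrum (𝓞 K))) (v : HeightOneSpectrum (𝓞 K)) :
    SingularQuotient (GaloisRep.toLocal v (κ.coeffLevelQuot ρ t I hI J hJ e he ht (k + 1) n)) →+
      SingularQuotient (GaloisRep.toLocal v (κ.coeffLevelQuot ρ t I hI J hJ e he ht k n)) :=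
  singularQuotientMap (κ.coeffLevelQuot ρ t I hI J hJ e he ht (k + 1) n) (κ.coeffLevelQuot ρ t I hI J hJ e he ht k n) v
    (κ.coeffLevelQuotRed ρ t I hI J hJ e he ht n₀ hn₀ hkt k n).toAddMonoidHom
    fun _ y ↦ κ.coeffLevelQuotRed_equivariant ρ t I hI J hJ e he ht n₀ hn₀ hkt k n _ y

end Tower

/-! ### Shifting an ordinary filtration by one level -/

section Shift

variable {K : Type} [Field K] [NumberField K] {p : ℕ} [hp : Fact p.Prime]
  {M : ℕ → Type} [∀ k, AddCommGroup (M k)] [∀ k, TopologicalSpace (M k)] [∀ k, DiscreteTopology (M k)]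
  {ρ : ∀ k, DiscreteGaloisModule K (M k)}
  {t : ∀ k, (ρ (k + 1)).toContRepresentation →ⁱL (ρ k).toContRepresentation} {v : HeightOneSpectrum (𝓞 K)}

/-- **The shift `(Fil_v M_{j+1})_j` of an ordinary filtration** along `j ↦ j+1` (same plus parts, re-indexed).
[cite: Howard2004HeegnerKolyvagin, Def. 2.2.5 (Fil_v 𝐓 = lim Ind Fil_v T)] -/
def OrdinaryFiltration.succ (Φ : OrdinaryFiltration ρ t v) :
    OrdinaryFiltration (fun j ↦ ρ (j + 1)) (fun j ↦ t (j + 1)) v where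
  fil j := Φ.fil (j + 1)
  smul_mem j σ a ha := Φ.smul_mem (j + 1) σ a ha
  map_mem j a ha := Φ.map_mem (j + 1) a ha

/-- Unfolding the shift. [cite: Howard2004HeegnerKolyvagin, Def. 2.2.5] -/
@[simp]
theorem OrdinaryFiltration.succ_fil (Φ : OrdinaryFiltration ρ t v) (j : ℕ) : Φ.succ.fil j = Φ.fil (j + 1) := rfl

end Shift

end Literature.NumberTheory.EllipticCurves.ZpExtension

/-! ## §2 The curve: the shifted Shapiro tower `𝐓_j = E_K[p^{j+1}] ⊗ Λ/(ω_{j+1}, p^{j+1})` and the setting `S_Λ` -/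

namespace WeierstrassCurve

open Literature.NumberTheory.EllipticCurves Literature.NumberTheory.GaloisRepresentations
open Literature.NumberTheory.GaloisRepresentations.DiscreteGaloisModule
open Literature.NumberTheory.GaloisCohomology.Howard2004
open Literature.NumberTheory.EllipticCurves.ZpExtension

variable {K : Type} [Field K] [NumberField K] (W : WeierstrassCurve ℚ) [W.IsElliptic] {p : ℕ} [hp : Fact p.Prime]
  (κ : ZpExtension K p)

variable (K p) in
/-- **The level carriers `𝐓_j = E_K[p^{j+1}] ⊗ Λ/(ω_{j+1}, p^{j+1})`** (x9-p2's `CoeffLevel` on the shifted families; definitionally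
`CoeffLevel p (shapiroIdeal p) (fun k ↦ E_K[p^k]) (j+1)`).  An `abbrev`. [cite: Howard2004HeegnerKolyvagin, §2.2 Def. 2.2.3 (arXiv p0016 L47–55)] -/
abbrev ShapiroLevel (j : ℕ) : Type :=
  CoeffLevel p (fun j ↦ shapiroIdeal p (j + 1)) (fun j ↦ geomTorsion (W.baseChange K) ((p : ℤ) ^ (j + 1))) j

/-- The `Λ/(ω_{j+1}, p^{j+1})`-module structure on `𝐓_j` (x9-p2's `CoeffLevel.instModule`, restated for the SHIFTED family so
that instance resolution finds it under the binder `j`; definitionally the generic instance).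
[cite: Howard2004HeegnerKolyvagin, §2.2 (𝐓/I𝐓 is a Λ/I-module)] -/
instance ShapiroLevel.instModuleCoeff (j : ℕ) :
    Module (IwasawaAlgebra p ⧸ shapiroIdeal p (j + 1)) (W.ShapiroLevel K p j) :=
  CoeffLevel.instModule p (fun j ↦ geomTorsion (W.baseChange K) ((p : ℤ) ^ (j + 1))) (fun j ↦ shapiroIdeal p (j + 1)) j

/-- The scalar tower `Λ → Λ/(ω_{j+1}, p^{j+1}) → End(𝐓_j)` for the shifted family (the generic
`CoeffLevel.instIsScalarTowerIwasawa`). [cite: Howard2004HeegnerKolyvagin, §1.6 (arXiv p. 11, L33–38)] -/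
instance ShapiroLevel.instIsScalarTowerCoeff (j : ℕ) :
    IsScalarTower (IwasawaAlgebra p) (IwasawaAlgebra p ⧸ shapiroIdeal p (j + 1)) (W.ShapiroLevel K p j) :=
  CoeffLevel.instIsScalarTowerIwasawa (fun j ↦ shapiroIdeal p (j + 1))
    (fun j ↦ geomTorsion (W.baseChange K) ((p : ℤ) ^ (j + 1))) j

variable (K p) in
/-- **x9-p2's (unshifted) Shapiro-diagonal tower `k ↦ E_K[p^k] ⊗ (Λ/(ω_k, p^k))(χ)`** — the codomain tower of
`LambdaAdicSelmerData.toShapiroLimitH1` (an `abbrev` naming that term; level `0` is `0`).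
[cite: Howard2004HeegnerKolyvagin, §2.2 Def. 2.2.1–2.2.3 (arXiv p0016 L12–55)] -/
abbrev shapiroTowerUnshifted :
    AdicTower K (IwasawaAlgebra p) (CoeffLevel p (shapiroIdeal p) (fun k ↦ geomTorsion (W.baseChange K) ((p : ℤ) ^ k))) :=
  κ.coeffAdicTower (fun k ↦ (W.baseChange K).torsionGaloisModule ((p : ℤ) ^ k))
    (fun k ↦ (W.baseChange K).torsionGaloisModuleReduce p k) (shapiroIdeal p) (shapiroIdeal_succ_le p) (fun k ↦ k)
    (omega_mem_shapiroIdeal p) (fun k ↦ k * p ^ k + k) (maximalIdeal_pow_le_shapiroIdeal p)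
    (fun k ↦ (W.baseChange K).torsionGaloisModuleReduce_surjective p k)

variable (K p) in
/-- **The shifted Shapiro tower `𝐓_j = E_K[p^{j+1}] ⊗ (Λ/(ω_{j+1}, p^{j+1}))(χ) = Ind_{K_{j+1}/K} E_K[p^{j+1}]`** as a term of
`Howard2004.AdicTower K Λ`: x9-p2's `coeffAdicTower` for the `ℤ_p`-extension `κ₀` (consumers: `κ₀ = κ.unitTwist (-1)`,
CGLS's `Ψ⁻¹`, the twist of `toShapiroLimitH1` and of the D1 target) on the shifted families (torsion `E_K[p^{j+1}]`,
transitions `P ↦ pP`, ideals `(ω_{j+1}, p^{j+1})`, layers `j+1`, exponents `(j+1)p^{j+1} + (j+1)`).  An `abbrev`.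
[cite: Howard2004HeegnerKolyvagin, §2.2 Def. 2.2.3 (arXiv p0016 L47–55)] [cite: CastellaGrossiLeeSkinner2022, §3.4 (arXiv v2 TeX L2083: 𝐓 ≃ T_pE ⊗ Λ, Ψ⁻¹)] -/
abbrev shapiroTower : AdicTower K (IwasawaAlgebra p) (W.ShapiroLevel K p) :=
  κ.coeffAdicTower (fun j ↦ (W.baseChange K).torsionGaloisModule ((p : ℤ) ^ (j + 1)))
    (fun j ↦ (W.baseChange K).torsionGaloisModuleReduce p (j + 1)) (fun j ↦ shapiroIdeal p (j + 1))
    (fun j ↦ shapiroIdeal_succ_le p (j + 1)) (fun j ↦ j + 1) (fun j ↦ omega_mem_shapiroIdeal p (j + 1))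
    (fun j ↦ (j + 1) * p ^ (j + 1) + (j + 1)) (fun j ↦ maximalIdeal_pow_le_shapiroIdeal p (j + 1))
    (fun j ↦ (W.baseChange K).torsionGaloisModuleReduce_surjective p (j + 1))

/-- **Level `j` of the shifted tower IS Shapiro level `j+1` of the unshifted tower** of x9-p2's `toShapiroLimitH1`,
definitionally. [cite: Howard2004HeegnerKolyvagin, §2.2 Def. 2.2.3 (any cofinal family presents 𝐓)] -/
theorem shapiroTower_ρ (j : ℕ) : (W.shapiroTower K p κ).ρ j = (W.shapiroTowerUnshifted K p κ).ρ (j + 1) :=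
  rfl

/-- The reductions of the shifted tower are those of the unshifted tower one level up, definitionally.
[cite: Howard2004HeegnerKolyvagin, §2.2 Def. 2.2.3] -/
theorem shapiroTower_red_apply (j : ℕ) (x : W.ShapiroLevel K p (j + 1)) :
    (W.shapiroTower K p κ).red j x = (W.shapiroTowerUnshifted K p κ).red (j + 1) x :=
  rfl

/-- The reductions on `H¹` of the shifted tower are those of the unshifted tower one level up.
[cite: Howard2004HeegnerKolyvagin, §2.2 Def. 2.2.3 and §1.6 (arXiv p. 12)] -/
theorem shapiroTower_redH1 (j : ℕ) (y : galoisCohomology ((W.shapiroTower K p κ).ρ (j + 1)) 1) :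
    (W.shapiroTower K p κ).redH1 j y = (W.shapiroTowerUnshifted K p κ).redH1 (j + 1) y := by
  unfold AdicTower.redH1
  rfl

/-- A compatible family on the unshifted tower, read from level `1` on, is a compatible family on the shifted tower.
[cite: Howard2004HeegnerKolyvagin, §1.6 (arXiv p. 12, L29–55: lim over any cofinal family)] -/
theorem shift_mem_limitH1 (x : ∀ k, galoisCohomology ((W.shapiroTowerUnshifted K p κ).ρ k) 1)
    (hx : x ∈ (W.shapiroTowerUnshifted K p κ).limitH1) :
    (fun j ↦ x (j + 1) : ∀ j, galoisCohomology ((W.shapiroTower K p κ).ρ j) 1) ∈ (W.shapiroTower K p κ).limitH1 := by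
  intro j
  rw [shapiroTower_redH1]
  exact hx (j + 1)

/-- **The shift `lim_k H¹(K, Ind_{K_k} E[p^k]) → lim_j H¹(K, 𝐓_j)`**, `x ↦ (x_{j+1})_j` (forget level `0`, which is `0`):
an additive map between the limits of the unshifted and the shifted tower. [cite: Howard2004HeegnerKolyvagin, §1.6 and §2.2 Def. 2.2.3] -/
def limitH1Shift : (W.shapiroTowerUnshifted K p κ).limitH1 →+ (W.shapiroTower K p κ).limitH1 where
  toFun x := ⟨fun j ↦ x.1 (j + 1), W.shift_mem_limitH1 κ x.1 x.2⟩
  map_zero' := rfl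
  map_add' _ _ := rfl

/-- Unfolding the shift: `(shift x)_j = x_{j+1}`. [cite: Howard2004HeegnerKolyvagin, §2.2 Def. 2.2.3] -/
@[simp]
theorem limitH1Shift_apply (x : (W.shapiroTowerUnshifted K p κ).limitH1) (j : ℕ) :
    (W.limitH1Shift κ x).1 j = x.1 (j + 1) :=
  rfl

/-- The levels `𝐓_j` are finite. [cite: Howard2004HeegnerKolyvagin, §2.2 (𝐓/I𝐓 finite)] [cite: SilvermanAEC2009, Cor. III.6.4] -/
theorem finite_shapiroLevel (j : ℕ) : Finite (W.ShapiroLevel K p j) := by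
  haveI : ∀ k, Finite (geomTorsion (W.baseChange K) ((p : ℤ) ^ (k + 1))) := fun k ↦
    finite_torsionPoints_holds (W.baseChange K) (AlgebraicClosure K) (pow_ne_zero _ (by exact_mod_cast hp.out.ne_zero))
  exact finite_coeffLevel (p := p) (fun j ↦ shapiroIdeal p (j + 1)) (fun j ↦ (j + 1) * p ^ (j + 1) + (j + 1))
    (fun j ↦ maximalIdeal_pow_le_shapiroIdeal p (j + 1)) (fun j ↦ geomTorsion (W.baseChange K) ((p : ℤ) ^ (j + 1))) j

/-- **The levels `𝐓_j` are free `Λ/(ω_{j+1}, p^{j+1})`-modules** (`E[p^k] ≅ (ℤ/p^k)²`, generic `CoeffExtension.free_of_addEquiv`)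
— the freeness clause of Howard's H.0 for the `Λ`-adic levels, used here to certify the tame slots (`Frob_λ ≡ 1` on
`𝐓_j/I_n` for `λ ∈ n`). [cite: Howard2004HeegnerKolyvagin, §1.3 H.0 and §2.2 (𝐓 ≅ T ⊗ Λ free of rank two)] [cite: SilvermanAEC2009, Cor. III.6.4(b)] -/
theorem free_shapiroLevel (j : ℕ) :
    Module.Free (IwasawaAlgebra p ⧸ shapiroIdeal p (j + 1)) (W.ShapiroLevel K p j) := by
  have hpK : (p : K) ≠ 0 := by exact_mod_cast hp.out.ne_zero
  obtain ⟨e⟩ := (W.baseChange K).nonempty_geomTorsion_prime_pow_addEquiv_fin_two hpK (j + 1)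
  exact CoeffExtension.free_of_addEquiv (natCast_pow_eq_zero_quotient_shapiroIdeal p (j + 1)) e

/-- The canonical Kolyvagin quotients `𝐓_j/I_n 𝐓_j` are finite. [cite: Howard2004HeegnerKolyvagin, Def. 1.2.3 (arXiv p. 7, L1–6)] -/
theorem finite_shapiroLevelQuotCarrier (j : ℕ) (n : Finset (HeightOneSpectrum (𝓞 K))) :
    Finite (LevelData.QuotCarrier (IwasawaAlgebra p ⧸ shapiroIdeal p (j + 1)) ((W.shapiroTower K p κ).ρ j) n) := by
  haveI := W.finite_shapiroLevel (K := K) (p := p) j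
  exact Finite.of_surjective (Submodule.mkQ _) (Submodule.mkQ_surjective _)

/-- **`𝐓_j` is unramified at every good place `v ∤ p`**: inertia at `v` lies in `ker κ₀` (Washington 13.2) and acts
trivially on `E_K[p^{j+1}]` (Néron–Ogg–Shafarevich). [cite: SilvermanAEC2009, Prop. VII.4.1(a)] [cite: Washington1997, Prop. 13.2] [cite: Howard2004HeegnerKolyvagin, §2.2 (𝐓 unramified outside pN)] -/
theorem isUnramifiedAt_shapiroTower {v : HeightOneSpectrum (𝓞 K)} (hv : (W.baseChange K).HasGoodReductionAt v)
    (hpv : ((p : ℕ) : 𝓞 K) ∉ v.asIdeal) (j : ℕ) : GaloisRep.IsUnramifiedAt v ((W.shapiroTower K p κ).ρ j) := by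
  intro 𝔓 h𝔓 τ hτ
  have hτk : τ ∈ κ.kerSubgroup := ZpExtension.inertia_le_kerSubgroup_holds K p κ hpv h𝔓 hτ
  have hn : ((((p : ℤ) ^ (j + 1) : ℤ) : 𝓞 K)) ∉ v.asIdeal := fun h ↦ hpv <| by
    rw [Int.cast_pow, Int.cast_natCast] at h
    exact v.isPrime.mem_of_pow_mem (j + 1) h
  refine LinearMap.ext fun x ↦ ?_
  change (W.shapiroTower K p κ).ρ j τ x = x
  exact κ.coeffTwist_apply_eq_self_of_mem_kerSubgroup ((W.baseChange K).torsionGaloisModule ((p : ℤ) ^ (j + 1)))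
    (mk_one_add_X_pow_prime_pow_eq_one (shapiroIdeal p (j + 1)) (omega_mem_shapiroIdeal p (j + 1))) hτk
    (fun P ↦ by
      rw [torsionGaloisModule_apply_apply]
      exact (W.baseChange K).smul_geomTorsion_eq_of_mem_inertia hv hn h𝔓 hτ P) x

/-- `Γ_K` acts `Λ/(ω_{j+1}, p^{j+1})`-linearly on `𝐓_j` («`𝐓_j ∈ Mod_{R_j, K}`», the input of `LevelData.canonical`).
[cite: Howard2004HeegnerKolyvagin, §1.6 (arXiv p. 11, L33–38) and §2.2] -/
theorem isScalarLinear_shapiroTower_coeff (j : ℕ) :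
    ((W.shapiroTower K p κ).ρ j).IsScalarLinear (IwasawaAlgebra p ⧸ shapiroIdeal p (j + 1)) :=
  κ.isScalarLinear_coeffAdicTower_coeff (fun j ↦ (W.baseChange K).torsionGaloisModule ((p : ℤ) ^ (j + 1)))
    (fun j ↦ (W.baseChange K).torsionGaloisModuleReduce p (j + 1)) (fun j ↦ shapiroIdeal p (j + 1))
    (fun j ↦ shapiroIdeal_succ_le p (j + 1)) (fun j ↦ j + 1) (fun j ↦ omega_mem_shapiroIdeal p (j + 1))
    (fun j ↦ (j + 1) * p ^ (j + 1) + (j + 1)) (fun j ↦ maximalIdeal_pow_le_shapiroIdeal p (j + 1))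
    (fun j ↦ (W.baseChange K).torsionGaloisModuleReduce_surjective p (j + 1)) j

section Triple

variable (S : Finset (HeightOneSpectrum (𝓞 K)))
  (hpS : ∀ v : HeightOneSpectrum (𝓞 K), ((p : ℕ) : 𝓞 K) ∈ v.asIdeal → v ∈ S)
  (hbad : ∀ v : HeightOneSpectrum (𝓞 K), v ∉ S → ((p : ℕ) : 𝓞 K) ∉ v.asIdeal → (W.baseChange K).HasGoodReductionAt v)

include hpS hbad in
/-- The ramified places of `𝐓_j` lie in `S` (`S ⊇ {v ∣ p}`, good reduction off `S`). [cite: Howard2004HeegnerKolyvagin, §1.1 (Σ(𝓕) contains the ramified primes) and §2.2] -/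
theorem mem_of_not_isUnramifiedAt_shapiroTower (j : ℕ) (v : HeightOneSpectrum (𝓞 K))
    (hv : ¬ GaloisRep.IsUnramifiedAt v ((W.shapiroTower K p κ).ρ j)) : v ∈ S := by
  by_contra hvS
  have hpv : ((p : ℕ) : 𝓞 K) ∉ v.asIdeal := fun h ↦ hvS (hpS v h)
  exact hv (W.isUnramifiedAt_shapiroTower κ (hbad v hvS hpv) hpv j)

variable (L : Set (HeightOneSpectrum (𝓞 K))) (hL : L ⊆ (W.shapiroTower K p κ).degreeTwoPrimes p) (hLS : ∀ v ∈ L, v ∉ S)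

/-- **The Selmer triple `(𝐓_j, 𝓕_Λ, 𝓛)` of the curve at tower level `j`** (Shapiro level `j+1`): A1's `coeffSelmerTriple` with the
ordinary data `ordinaryFiltrationAt` (shifted) at `v ∣ p`, `Σ(𝓕_Λ) = ∞ ∪ S`, and the prime set `𝓛`.
[cite: Howard2004HeegnerKolyvagin, §1.2 (arXiv p. 6, L96–100), Def. 2.2.6 and §2.3] [cite: CastellaGrossiLeeSkinner2022, §3.4 (𝓕_Λ, Σ = {w ∣ pN∞})] -/
def shapiroTowerTriple (j : ℕ) : SelmerTriple p ((W.shapiroTower K p κ).ρ j) :=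
  κ.coeffSelmerTriple (fun j ↦ (W.baseChange K).torsionGaloisModule ((p : ℤ) ^ (j + 1)))
    (fun j ↦ (W.baseChange K).torsionGaloisModuleReduce p (j + 1)) (fun j ↦ shapiroIdeal p (j + 1))
    (fun j ↦ shapiroIdeal_succ_le p (j + 1)) (fun j ↦ j + 1) (fun j ↦ omega_mem_shapiroIdeal p (j + 1))
    (fun j ↦ (j + 1) * p ^ (j + 1) + (j + 1)) (fun j ↦ maximalIdeal_pow_le_shapiroIdeal p (j + 1))
    (fun j ↦ (W.baseChange K).torsionGaloisModuleReduce_surjective p (j + 1)) S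
    (fun v _ ↦ ((W.baseChange K).ordinaryFiltrationAt v (fun k ↦ (W.baseChange K).torsionGaloisModuleReduce p k)
      (fun _ _ ↦ rfl)).succ)
    hpS (fun j v hv ↦ W.mem_of_not_isUnramifiedAt_shapiroTower κ S hpS hbad j v hv) L hL hLS j

/-- The prime set of every level triple is `𝓛` (the input `hL` of `KolyvaginSystem.ofHom` / `fsAdmissible_of_fs_eq_tameSlotOn_levels`).
[cite: Howard2004HeegnerKolyvagin, §2.3 (arXiv p0018 L65)] -/
@[simp]
theorem shapiroTowerTriple_primes (j : ℕ) : (W.shapiroTowerTriple κ S hpS hbad L hL hLS j).primes = L := rfl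

/-- `Σ(𝓕_Λ) = ∞ ∪ S` at every level. [cite: CastellaGrossiLeeSkinner2022, §3.4 (Σ = {w ∣ pN} ∪ ∞)] -/
@[simp]
theorem shapiroTowerTriple_Sigma (j : ℕ) :
    (W.shapiroTowerTriple κ S hpS hbad L hL hLS j).Sigma = (Finset.univ : Finset (NumberField.InfinitePlace K)).disjSum S :=
  rfl

end Triple

/-! ### The canonical Kolyvagin quotients of the curve's tower and their reductions -/

/-- **The canonical Kolyvagin quotient `𝐓_j/I_n 𝐓_j` of the curve** (`modIdeal` over `Λ/(ω_{j+1}, p^{j+1})`).  An `abbrev`.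
[cite: Howard2004HeegnerKolyvagin, Def. 1.2.1 and Def. 1.2.3 (arXiv p. 6 L73–75, p. 7 L1–6)] -/
abbrev shapiroLevelQuot (j : ℕ) (n : Finset (HeightOneSpectrum (𝓞 K))) :
    DiscreteGaloisModule K (LevelData.QuotCarrier (IwasawaAlgebra p ⧸ shapiroIdeal p (j + 1))
      ((W.shapiroTower K p κ).ρ j) n) :=
  κ.coeffLevelQuot (fun j ↦ (W.baseChange K).torsionGaloisModule ((p : ℤ) ^ (j + 1)))
    (fun j ↦ (W.baseChange K).torsionGaloisModuleReduce p (j + 1)) (fun j ↦ shapiroIdeal p (j + 1))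
    (fun j ↦ shapiroIdeal_succ_le p (j + 1)) (fun j ↦ j + 1) (fun j ↦ omega_mem_shapiroIdeal p (j + 1))
    (fun j ↦ (j + 1) * p ^ (j + 1) + (j + 1)) (fun j ↦ maximalIdeal_pow_le_shapiroIdeal p (j + 1))
    (fun j ↦ (W.baseChange K).torsionGaloisModuleReduce_surjective p (j + 1)) j n

/-- `p^{j+1} ∈ (ω_{j+1}, p^{j+1})` as an integer. [cite: Washington1997, §13.2] -/
theorem intCast_pow_mem_shapiroIdeal_succ (j : ℕ) :
    ((((p : ℤ) ^ (j + 1) : ℤ)) : IwasawaAlgebra p) ∈ shapiroIdeal p (j + 1) := by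
  rw [Int.cast_pow, Int.cast_natCast]
  exact natCast_pow_mem_shapiroIdeal p (j + 1)

/-- **The reduction `𝐓_{j+1}/I_n → 𝐓_j/I_n` of the curve's canonical Kolyvagin quotients** (`coeffLevelQuotRed`, `Λ`-linear; kernel
input `ker (p ·) = p^{j+1} E[p^{j+2}]`, `torsionGaloisModuleReduce_eq_zero_iff`). [cite: Howard2004HeegnerKolyvagin, §1.6 (arXiv p. 11, L49–50) and Def. 1.2.3] -/
abbrev shapiroLevelQuotRed (j : ℕ) (n : Finset (HeightOneSpectrum (𝓞 K))) :
    LevelData.QuotCarrier (IwasawaAlgebra p ⧸ shapiroIdeal p (j + 1 + 1)) ((W.shapiroTower K p κ).ρ (j + 1)) n →ₗ[IwasawaAlgebra p]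
      LevelData.QuotCarrier (IwasawaAlgebra p ⧸ shapiroIdeal p (j + 1)) ((W.shapiroTower K p κ).ρ j) n :=
  κ.coeffLevelQuotRed (fun j ↦ (W.baseChange K).torsionGaloisModule ((p : ℤ) ^ (j + 1)))
    (fun j ↦ (W.baseChange K).torsionGaloisModuleReduce p (j + 1)) (fun j ↦ shapiroIdeal p (j + 1))
    (fun j ↦ shapiroIdeal_succ_le p (j + 1)) (fun j ↦ j + 1) (fun j ↦ omega_mem_shapiroIdeal p (j + 1))
    (fun j ↦ (j + 1) * p ^ (j + 1) + (j + 1)) (fun j ↦ maximalIdeal_pow_le_shapiroIdeal p (j + 1))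
    (fun j ↦ (W.baseChange K).torsionGaloisModuleReduce_surjective p (j + 1)) (fun j ↦ (p : ℤ) ^ (j + 1))
    (fun j ↦ intCast_pow_mem_shapiroIdeal_succ (p := p) j)
    (fun j x hx ↦ ((W.baseChange K).torsionGaloisModuleReduce_eq_zero_iff p (j + 1) x).mp hx) j n

/-- The reduction of the curve's canonical Kolyvagin quotients is `Γ_K`-equivariant (the field `rq_equivariant`).
[cite: Howard2004HeegnerKolyvagin, §1.6 (arXiv p. 11, L49–50) and Def. 1.1.3] -/
theorem shapiroLevelQuotRed_equivariant (j : ℕ) (n : Finset (HeightOneSpectrum (𝓞 K))) (g : absoluteGaloisGroup K)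
    (y : LevelData.QuotCarrier (IwasawaAlgebra p ⧸ shapiroIdeal p (j + 1 + 1)) ((W.shapiroTower K p κ).ρ (j + 1)) n) :
    W.shapiroLevelQuotRed κ j n (W.shapiroLevelQuot κ (j + 1) n g y) =
      W.shapiroLevelQuot κ j n g (W.shapiroLevelQuotRed κ j n y) :=
  κ.coeffLevelQuotRed_equivariant (fun j ↦ (W.baseChange K).torsionGaloisModule ((p : ℤ) ^ (j + 1)))
    (fun j ↦ (W.baseChange K).torsionGaloisModuleReduce p (j + 1)) (fun j ↦ shapiroIdeal p (j + 1))
    (fun j ↦ shapiroIdeal_succ_le p (j + 1)) (fun j ↦ j + 1) (fun j ↦ omega_mem_shapiroIdeal p (j + 1))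
    (fun j ↦ (j + 1) * p ^ (j + 1) + (j + 1)) (fun j ↦ maximalIdeal_pow_le_shapiroIdeal p (j + 1))
    (fun j ↦ (W.baseChange K).torsionGaloisModuleReduce_surjective p (j + 1)) (fun j ↦ (p : ℤ) ^ (j + 1))
    (fun j ↦ intCast_pow_mem_shapiroIdeal_succ (p := p) j)
    (fun j x hx ↦ ((W.baseChange K).torsionGaloisModuleReduce_eq_zero_iff p (j + 1) x).mp hx) j n g y

/-- **The reduction on singular quotients `H¹_s(K_v, 𝐓_{j+1}/I_n) → H¹_s(K_v, 𝐓_j/I_n)`** of the curve's tower (lit's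
`singularQuotientMap` of `rq`; the field `fsQ`).  An `abbrev`.
[cite: Howard2004HeegnerKolyvagin, Def. 1.2.3 display (ks relations) and §1.6 (arXiv p. 6 L126–140, p. 11 L49–50)] -/
abbrev shapiroLevelQuotRedSingular (j : ℕ) (n : Finset (HeightOneSpectrum (𝓞 K))) (v : HeightOneSpectrum (𝓞 K)) :
    SingularQuotient (GaloisRep.toLocal v (W.shapiroLevelQuot κ (j + 1) n)) →+
      SingularQuotient (GaloisRep.toLocal v (W.shapiroLevelQuot κ j n)) :=
  κ.coeffLevelQuotRedSingular (fun j ↦ (W.baseChange K).torsionGaloisModule ((p : ℤ) ^ (j + 1)))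
    (fun j ↦ (W.baseChange K).torsionGaloisModuleReduce p (j + 1)) (fun j ↦ shapiroIdeal p (j + 1))
    (fun j ↦ shapiroIdeal_succ_le p (j + 1)) (fun j ↦ j + 1) (fun j ↦ omega_mem_shapiroIdeal p (j + 1))
    (fun j ↦ (j + 1) * p ^ (j + 1) + (j + 1)) (fun j ↦ maximalIdeal_pow_le_shapiroIdeal p (j + 1))
    (fun j ↦ (W.baseChange K).torsionGaloisModuleReduce_surjective p (j + 1)) (fun j ↦ (p : ℤ) ^ (j + 1))
    (fun j ↦ intCast_pow_mem_shapiroIdeal_succ (p := p) j)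
    (fun j x hx ↦ ((W.baseChange K).torsionGaloisModuleReduce_eq_zero_iff p (j + 1) x).mp hx) j n v

/-! ### The residual data `T̄ = E_K[p]` -/

variable (K p) in
/-- The residual `Λ/(ω_{j+1}, p^{j+1})`-module structures on `T̄ = E_K[p]` through the residue characters, as a family (use with
`letI`; CONSUMER PREAMBLE). [cite: Howard2004HeegnerKolyvagin, §1.3 H.1 and proof of Prop. 2.1.3] -/
abbrev shapiroResidueModule (j : ℕ) :
    Module (IwasawaAlgebra p ⧸ shapiroIdeal p (j + 1)) (geomTorsion (W.baseChange K) (p : ℤ)) :=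
  ZpExtension.shapiroResidueModule (p := p) (k := j + 1) j.succ_pos
    ((W.baseChange K).prime_nsmul_geomTorsion_eq_zero (p := p))

omit [W.IsElliptic] in
/-- **The H.5(a) datum for `T̄ = E_K[p]` over the Shapiro level ring**: `θ = τ_*`, `Λ/(ω_{j+1}, p^{j+1})`-linear (the scalars act
through `𝔽_p`), involutive, intertwining `ρ̄ ∘ (τ⁻¹ · τ)` and `ρ̄` — verbatim the D1 road's `residualTauGeomTorsion`.
[cite: Howard2004HeegnerKolyvagin, §1.3 H.5(a) (arXiv p. 7, L93–95) and proof of Prop. 2.1.3] -/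
def residualTauShapiro (cd : ConjugationDatum K) (j : ℕ) :
    letI := W.shapiroResidueModule K p j
    ResidualTau (R := IwasawaAlgebra p ⧸ shapiroIdeal p (j + 1)) cd ((W.baseChange K).torsionGaloisModule (p : ℤ)) :=
  letI := W.shapiroResidueModule K p j
  { θ :=
      { toFun := cd.isLift.torsionMap W (p : ℤ)
        map_add' := map_add _
        map_smul' := fun c P ↦ by
          rw [RingHom.id_apply, ZpExtension.shapiroResidueModule_smul p j.succ_pos, map_nsmul,
            ZpExtension.shapiroResidueModule_smul p j.succ_pos] }
    involutive := fun P ↦ by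
      apply Subtype.ext
      change cd.isLift.pointsMap W (cd.isLift.pointsMap W (P : geomPoints (W.baseChange K))) = P
      generalize (P : geomPoints (W.baseChange K)) = Q
      change ((W.baseChange K).baseChange (AlgebraicClosure K)).toAffine.Point at Q
      rcases Q with _ | ⟨x, y, h⟩
      · rfl
      · exact Affine.Point.some_eq_some_of_eq (cd.involutive x) (cd.involutive y)
    compat := fun g P ↦ by
      change cd.isLift.torsionMap W (p : ℤ) ((W.baseChange K).torsionGaloisModule (p : ℤ) (cd.conj g) P) =
        (W.baseChange K).torsionGaloisModule (p : ℤ) g (cd.isLift.torsionMap W (p : ℤ) P)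
      rw [torsionGaloisModule_apply_apply, torsionGaloisModule_apply_apply]
      exact cd.isLift.torsionMap_smul W (p : ℤ) g P }

omit [W.IsElliptic] in
/-- Unfolding `residualTauShapiro`: `θ P = τ_* P`. [cite: Howard2004HeegnerKolyvagin, §1.3 H.5(a)] -/
theorem residualTauShapiro_θ_apply (cd : ConjugationDatum K) (j : ℕ) (P : geomTorsion (W.baseChange K) (p : ℤ)) :
    letI := W.shapiroResidueModule K p j
    (W.residualTauShapiro (K := K) (p := p) cd j).θ P = cd.isLift.torsionMap W (p : ℤ) P :=
  rfl

/-! ### `Φ'` : x9-p2's comparison `Φ` read on the shifted tower (twist `κ.unitTwist (-1)`) -/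

section Phi

variable {κ} {γ : absoluteGaloisGroup K} (D : (W.baseChange K).LambdaAdicSelmerData κ γ)
  (hγ : κ.IsTopGenerator γ) (hE : ∀ P : (W.baseChange K).toAffine.Point, p • P = 0 → P = 0)

/-- **x9-p2's `Φ : 𝔖 → lim_k H¹(K, Ind_{K_k/K} E[p^k])`** at the transitions `P ↦ pP` (`torsionGaloisModuleReduce`,
`ht` by `rfl`): the comparison of Howard Def. 2.2.1–2.2.3 in the kernel, landing in the unshifted tower at the twist
`κ.unitTwist (-1)`.  An `abbrev` fixing the transition data. [cite: Howard2004HeegnerKolyvagin, §2.2 Def. 2.2.1–2.2.3 (arXiv p0016 L12–55)] -/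
abbrev shapiroPhi : D.S →+ (W.shapiroTowerUnshifted K p (κ.unitTwist (-1))).limitH1 :=
  D.toShapiroLimitH1 (fun k ↦ (W.baseChange K).torsionGaloisModuleReduce p k) (fun _ _ ↦ rfl)
    (fun k ↦ (W.baseChange K).torsionGaloisModuleReduce_surjective p k) hγ hE

/-- **`Φ' : 𝔖 → lim_j H¹(K, 𝐓_j)` on the shifted tower at the twist `κ.unitTwist (-1)`**: `Φ` followed by the shift,
`Φ'(z)_j = Φ(z)_{j+1}` (no transport: `shapiroTower_ρ`). [cite: Howard2004HeegnerKolyvagin, §2.2 Def. 2.2.1–2.2.3 (arXiv p0016 L12–55)] [cite: CastellaGrossiLeeSkinner2022, Rem. 4.1.4] -/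
def toShapiroSuccLimitH1 : D.S →+ (W.shapiroTower K p (κ.unitTwist (-1))).limitH1 :=
  (W.limitH1Shift (κ.unitTwist (-1))).comp (W.shapiroPhi D hγ hE)

/-- Unfolding: `(Φ' z)_j = (Φ z)_{j+1}`. [cite: Howard2004HeegnerKolyvagin, §2.2 Def. 2.2.3] -/
theorem toShapiroSuccLimitH1_apply (z : D.S) (j : ℕ) :
    (W.toShapiroSuccLimitH1 D hγ hE z).1 j = (W.shapiroPhi D hγ hE z).1 (j + 1) :=
  rfl

/-- **`Φ'` is `Λ`-linear** in the tower currency `smulFamily` (x9-p2's `toShapiroLimitH1_smul`).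
[cite: Howard2004HeegnerKolyvagin, §2.2 Def. 2.2.3 (𝔖 = H¹(K, 𝐓) as Λ-modules)] -/
theorem toShapiroSuccLimitH1_smul (g : IwasawaAlgebra p) (z : D.S) :
    (W.toShapiroSuccLimitH1 D hγ hE (g • z)).1 =
      (W.shapiroTower K p (κ.unitTwist (-1))).smulFamily g (W.toShapiroSuccLimitH1 D hγ hE z).1 := by
  funext j
  exact congrFun (D.toShapiroLimitH1_smul (fun k ↦ (W.baseChange K).torsionGaloisModuleReduce p k) (fun _ _ ↦ rfl)
    (fun k ↦ (W.baseChange K).torsionGaloisModuleReduce_surjective p k) hγ hE g z) (j + 1)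

end Phi

/-! ### The assembly `S_Λ` -/

section Setting

variable (S : Finset (HeightOneSpectrum (𝓞 K)))
  (hpS : ∀ v : HeightOneSpectrum (𝓞 K), ((p : ℕ) : 𝓞 K) ∈ v.asIdeal → v ∈ S)
  (hbad : ∀ v : HeightOneSpectrum (𝓞 K), v ∉ S → ((p : ℕ) : 𝓞 K) ∉ v.asIdeal → (W.baseChange K).HasGoodReductionAt v)
  (L : Set (HeightOneSpectrum (𝓞 K))) (hL : L ⊆ (W.shapiroTower K p κ).degreeTwoPrimes p) (hLS : ∀ v ∈ L, v ∉ S)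
  (jbar : AlgebraicClosure K →+* ℂ) (cd : ConjugationDatum K)
  (πbar : letI := W.shapiroResidueModule K p
    ∀ j, W.ShapiroLevel K p j →ₗ[IwasawaAlgebra p ⧸ shapiroIdeal p (j + 1)] geomTorsion (W.baseChange K) (p : ℤ))
  (D : ∀ j, DualityDatum p cd ((W.shapiroTower K p κ).ρ j) (IwasawaAlgebra p ⧸ shapiroIdeal p (j + 1)))
  (fs : ∀ (j : ℕ) (n : Finset (HeightOneSpectrum (𝓞 K))) (v : HeightOneSpectrum (𝓞 K)),
    galoisCohomology ((W.shapiroLevelQuot κ j n).toLocal (Sum.inr v)) 1 →+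
      SingularQuotient (GaloisRep.toLocal v (W.shapiroLevelQuot κ j n)) ⊗[ℤ] Gell v)

set_option synthInstance.maxHeartbeats 80000 in
/-- **The `Λ`-adic source setting `S_Λ = (𝐓, 𝓕_Λ, 𝓛)` of `E_K` as Howard's general tower data** `CoeffTowerSetting p K Λ …`:
`R = Λ`, exponents `e_j = (j+1)p^{j+1} + (j+1)`, tower `𝐓_j = E_K[p^{j+1}] ⊗ Λ/(ω_{j+1}, p^{j+1})(χ_{κ₀})`, triples `(𝐓_j, 𝓕_Λ, 𝓛)`,
residual `T̄ = E_K[p]` with `θ = τ_*`, level rings `Λ/(ω_{j+1}, p^{j+1})` with reductions `factor`, CANONICAL Kolyvagin quotients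
`𝐓_j ⧸ I_n • 𝐓_j` with their reductions `rq` and singular-quotient maps `fsQ`; the conjugation datum `cd`, embedding `jbar`,
residual presentations `πbar`, pairing data `D`, finite–singular maps `fs`, prime set `𝓛` and bad set `S` are the caller's
(module docstring).  NOTHING is asserted about `S_Λ`. [cite: Howard2004HeegnerKolyvagin, §1.6 (arXiv p. 11 L13–38), Def. 1.2.3, Rem. 1.2.4, §2.2 Def. 2.2.3–2.2.6, §2.3] [cite: CastellaGrossiLeeSkinner2022, §3.4 and Thm. 4.1.1 ((𝐓, 𝓕_Λ, 𝓛_E))] -/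
def shapiroSetting :
    letI := W.shapiroResidueModule K p
    CoeffTowerSetting p K (IwasawaAlgebra p) (W.ShapiroLevel K p) (fun j ↦ IwasawaAlgebra p ⧸ shapiroIdeal p (j + 1))
      (geomTorsion (W.baseChange K) (p : ℤ))
      (fun j n ↦ LevelData.QuotCarrier (IwasawaAlgebra p ⧸ shapiroIdeal p (j + 1)) ((W.shapiroTower K p κ).ρ j) n) :=
  letI := W.shapiroResidueModule K p
  { e := fun j ↦ (j + 1) * p ^ (j + 1) + (j + 1)
    T := W.shapiroTower K p κ
    cd := cd
    jbar := jbar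
    Sigma := (Finset.univ : Finset (NumberField.InfinitePlace K)).disjSum S
    L := L
    t := W.shapiroTowerTriple κ S hpS hbad L hL hLS
    ρbar := (W.baseChange K).torsionGaloisModule (p : ℤ)
    πbar := πbar
    A := fun j ↦ W.residualTauShapiro (K := K) (p := p) cd j
    D := D
    redR := fun j ↦ Ideal.Quotient.factor (shapiroIdeal_succ_le p (j + 1))
    LD := fun j ↦ LevelData.canonical (IwasawaAlgebra p ⧸ shapiroIdeal p (j + 1)) ((W.shapiroTower K p κ).ρ j)
      (W.isScalarLinear_shapiroTower_coeff κ j) (W.shapiroTowerTriple κ S hpS hbad L hL hLS j) (fs j)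
    rq := fun j n ↦ W.shapiroLevelQuotRed κ j n
    rq_comp := fun _ _ _ ↦ rfl
    rq_equivariant := fun j n g y ↦ W.shapiroLevelQuotRed_equivariant κ j n g y
    fsQ := fun j n v ↦ W.shapiroLevelQuotRedSingular κ j n v }

/-! ### Unfolding the assembly (every KS-relevant field BY NAME, `rfl`) -/

set_option synthInstance.maxHeartbeats 80000 in
/-- The tower of `S_Λ` is `shapiroTower`. [cite: Howard2004HeegnerKolyvagin, §2.2 Def. 2.2.3] -/
theorem shapiroSetting_T :
    letI := W.shapiroResidueModule K p
    (W.shapiroSetting κ S hpS hbad L hL hLS jbar cd πbar D fs).T = W.shapiroTower K p κ :=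
  rfl

set_option synthInstance.maxHeartbeats 80000 in
/-- The level triples of `S_Λ` are `shapiroTowerTriple` (`𝓕_Λ`, A1's `coeffSelmerStructure`). [cite: Howard2004HeegnerKolyvagin, Def. 2.2.6] -/
theorem shapiroSetting_t (j : ℕ) :
    letI := W.shapiroResidueModule K p
    (W.shapiroSetting κ S hpS hbad L hL hLS jbar cd πbar D fs).t j = W.shapiroTowerTriple κ S hpS hbad L hL hLS j :=
  rfl

set_option synthInstance.maxHeartbeats 80000 in
/-- The prime set of `S_Λ` is `𝓛`. [cite: Howard2004HeegnerKolyvagin, §2.3 (arXiv p0018 L65)] -/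
theorem shapiroSetting_L :
    letI := W.shapiroResidueModule K p
    (W.shapiroSetting κ S hpS hbad L hL hLS jbar cd πbar D fs).L = L :=
  rfl

set_option synthInstance.maxHeartbeats 80000 in
/-- The prime set of every level triple of `S_Λ` is the setting's `𝓛` (the hypothesis `hL` of `KolyvaginSystem.ofHom` and of
`fsAdmissible_of_fs_eq_tameSlotOn_levels`). [cite: Howard2004HeegnerKolyvagin, §2.3 (arXiv p0018 L65)] -/
theorem shapiroSetting_t_primes (j : ℕ) :
    letI := W.shapiroResidueModule K p
    ((W.shapiroSetting κ S hpS hbad L hL hLS jbar cd πbar D fs).t j).primes =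
      (W.shapiroSetting κ S hpS hbad L hL hLS jbar cd πbar D fs).L :=
  rfl

set_option synthInstance.maxHeartbeats 80000 in
/-- `jbar` is the caller's. [cite: Howard2004HeegnerKolyvagin, Def. 1.2.2] -/
theorem shapiroSetting_jbar :
    letI := W.shapiroResidueModule K p
    (W.shapiroSetting κ S hpS hbad L hL hLS jbar cd πbar D fs).jbar = jbar :=
  rfl

set_option synthInstance.maxHeartbeats 80000 in
/-- `Σ = ∞ ∪ S`. [cite: CastellaGrossiLeeSkinner2022, §3.4] -/
theorem shapiroSetting_Sigma :
    letI := W.shapiroResidueModule K p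
    (W.shapiroSetting κ S hpS hbad L hL hLS jbar cd πbar D fs).Sigma =
      (Finset.univ : Finset (NumberField.InfinitePlace K)).disjSum S :=
  rfl

set_option synthInstance.maxHeartbeats 80000 in
/-- The Galois actions of the Kolyvagin quotients of `S_Λ` are the canonical `shapiroLevelQuot`. [cite: Howard2004HeegnerKolyvagin, Def. 1.2.3] -/
theorem shapiroSetting_LD_ρq (j : ℕ) (n : Finset (HeightOneSpectrum (𝓞 K))) :
    letI := W.shapiroResidueModule K p
    ((W.shapiroSetting κ S hpS hbad L hL hLS jbar cd πbar D fs).LD j).ρq n = W.shapiroLevelQuot κ j n :=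
  rfl

set_option synthInstance.maxHeartbeats 80000 in
/-- The presentations of the Kolyvagin quotients of `S_Λ` are the quotient maps. [cite: Howard2004HeegnerKolyvagin, Def. 1.2.3] -/
theorem shapiroSetting_LD_π_apply (j : ℕ) (n : Finset (HeightOneSpectrum (𝓞 K))) (x : W.ShapiroLevel K p j) :
    letI := W.shapiroResidueModule K p
    ((W.shapiroSetting κ S hpS hbad L hL hLS jbar cd πbar D fs).LD j).π n x = Submodule.Quotient.mk x :=
  rfl

set_option synthInstance.maxHeartbeats 80000 in
/-- The finite–singular slots of `S_Λ` are the caller's `fs`. [cite: Howard2004HeegnerKolyvagin, Def. 1.1.8 / Def. 1.2.3] -/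
theorem shapiroSetting_LD_fs (j : ℕ) :
    letI := W.shapiroResidueModule K p
    ((W.shapiroSetting κ S hpS hbad L hL hLS jbar cd πbar D fs).LD j).fs = fs j :=
  rfl

set_option synthInstance.maxHeartbeats 80000 in
/-- The reductions of the Kolyvagin quotients of `S_Λ` are `shapiroLevelQuotRed`. [cite: Howard2004HeegnerKolyvagin, §1.6 (arXiv p. 11, L49–50)] -/
theorem shapiroSetting_rq (j : ℕ) (n : Finset (HeightOneSpectrum (𝓞 K))) :
    letI := W.shapiroResidueModule K p
    (W.shapiroSetting κ S hpS hbad L hL hLS jbar cd πbar D fs).rq j n = W.shapiroLevelQuotRed κ j n :=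
  rfl

set_option synthInstance.maxHeartbeats 80000 in
/-- **`fsQ_spec` for `S_Λ`**: `fsQ (singular x) = singular (H¹(rq_v) x)` (`rfl`: `fsQ` IS lit's `singularQuotientMap` of `rq` and
`rqLocH1` IS its `localH1Map`). [cite: Howard2004HeegnerKolyvagin, Def. 1.2.3 display (ks relations) (arXiv p. 6, L126–140)] -/
theorem shapiroSetting_fsQ_singularMap (j : ℕ) (n : Finset (HeightOneSpectrum (𝓞 K))) (v : HeightOneSpectrum (𝓞 K))
    (x : galoisCohomology (GaloisRep.toLocal v (W.shapiroLevelQuot κ (j + 1) n)) 1) :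
    letI := W.shapiroResidueModule K p
    (W.shapiroSetting κ S hpS hbad L hL hLS jbar cd πbar D fs).fsQ j n v (singularMap _ x) =
      singularMap _ ((W.shapiroSetting κ S hpS hbad L hL hLS jbar cd πbar D fs).rqLocH1 j n v x) :=
  rfl

/-! ### The slots `cd`, `πbar`, `D` are not read by `KolyvaginSystem` -/

set_option synthInstance.maxHeartbeats 80000 in
/-- **A Kolyvagin system for `S_Λ` with one choice of `(cd, πbar, D)` IS one for any other choice** (same classes, same bottom
class): `CoeffTowerSetting.KolyvaginSystem` reads only `T`, `t`, `jbar`, `L`, `LD`, `rq` (field by field, `rfl`).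
[cite: Howard2004HeegnerKolyvagin, Def. 1.2.3 (arXiv p. 7, L1–12: KS(T, 𝓕, 𝓛) depends on (T, 𝓕, 𝓛) only)] -/
def kolyvaginSystemCongr (cd' : ConjugationDatum K)
    (πbar' : letI := W.shapiroResidueModule K p
      ∀ j, W.ShapiroLevel K p j →ₗ[IwasawaAlgebra p ⧸ shapiroIdeal p (j + 1)] geomTorsion (W.baseChange K) (p : ℤ))
    (D' : ∀ j, DualityDatum p cd' ((W.shapiroTower K p κ).ρ j) (IwasawaAlgebra p ⧸ shapiroIdeal p (j + 1)))
    (ks : letI := W.shapiroResidueModule K p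
      (W.shapiroSetting κ S hpS hbad L hL hLS jbar cd πbar D fs).KolyvaginSystem) :
    letI := W.shapiroResidueModule K p
    (W.shapiroSetting κ S hpS hbad L hL hLS jbar cd' πbar' D' fs).KolyvaginSystem :=
  letI := W.shapiroResidueModule K p
  { κ := ks.κ
    ks := ks.ks
    κ_red := ks.κ_red
    one := ks.one
    one_mem := ks.one_mem
    κ_one := ks.κ_one }

set_option synthInstance.maxHeartbeats 80000 in
/-- The transport `kolyvaginSystemCongr` does not change the bottom class `κ_1`. [cite: Howard2004HeegnerKolyvagin, Def. 1.2.3] -/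
@[simp]
theorem kolyvaginSystemCongr_one (cd' : ConjugationDatum K)
    (πbar' : letI := W.shapiroResidueModule K p
      ∀ j, W.ShapiroLevel K p j →ₗ[IwasawaAlgebra p ⧸ shapiroIdeal p (j + 1)] geomTorsion (W.baseChange K) (p : ℤ))
    (D' : ∀ j, DualityDatum p cd' ((W.shapiroTower K p κ).ρ j) (IwasawaAlgebra p ⧸ shapiroIdeal p (j + 1)))
    (ks : letI := W.shapiroResidueModule K p
      (W.shapiroSetting κ S hpS hbad L hL hLS jbar cd πbar D fs).KolyvaginSystem) :
    letI := W.shapiroResidueModule K p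
    (W.kolyvaginSystemCongr κ S hpS hbad L hL hLS jbar cd πbar D fs cd' πbar' D' ks).one = ks.one :=
  rfl

/-! ### `LargePrimes` for `S_Λ` from `𝓛₁(𝐓) ⊆ 𝓛` -/

set_option synthInstance.maxHeartbeats 80000 in
/-- **`LargePrimes` for `S_Λ`** («`𝓛_s(𝐓) ⊂ 𝓛` for `s ≫ 0`», here `s₀ = 1`) as soon as `𝓛 ⊇ 𝓛₁(𝐓)`: `𝓛_s(𝐓) ⊆ 𝓛₁(𝐓)` for `s ≥ 1`
(`p ∣ p^s`).  For `𝓛 = 𝓛₁(𝐓) ∖ S` the hypothesis is «no prime of `S` is in `𝓛₁(𝐓)`» (under (Heeg): the primes of `N` split).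
[cite: Howard2004HeegnerKolyvagin, §1.6 (arXiv p. 11, L15–16) and §2.3 (𝓛 = 𝓛₁(𝐓))] -/
theorem shapiroSetting_largePrimes (h1 : (W.shapiroTower K p κ).kolyvaginPrimes p 1 ⊆ L) :
    letI := W.shapiroResidueModule K p
    (W.shapiroSetting κ S hpS hbad L hL hLS jbar cd πbar D fs).LargePrimes := by
  letI := W.shapiroResidueModule K p
  refine ⟨1, fun s hs v hv ↦ h1 ?_⟩
  have hle : Ideal.span {((p : ℕ) : IwasawaAlgebra p) ^ s} ≤ Ideal.span {((p : ℕ) : IwasawaAlgebra p) ^ 1} :=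
    Ideal.span_singleton_le_span_singleton.mpr (pow_dvd_pow _ hs)
  refine ⟨hv.1, hle hv.2.1, fun k σ hσ x ↦ ?_⟩
  exact Submodule.smul_mono_left hle (hv.2.2 k σ hσ x)

end Setting

/-! ### The tame instance: `fs :=` lit g32's guarded tame slots; `FsAdmissible`, `FsNatural` -/

section Tame

variable (π : ∀ v : HeightOneSpectrum (𝓞 K), TamePin v)
  (P : Finset (HeightOneSpectrum (𝓞 K)) → HeightOneSpectrum (𝓞 K) → Prop)
  (hP : ∀ j n v, P n v → TameHyp (fun n ↦ W.shapiroLevelQuot κ j n) n v)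

/-- **The guarded tame finite–singular slots of `S_Λ`** at tower level `j`: lit g32's `tameSlotOn` — on the guard `P n v`
(certified by `hP` to imply the hypotheses of Def. 1.1.8 for `𝐓_j/I_n` at `v`) Howard's comparison map with the pin `π v`;
elsewhere `0`. [cite: Howard2004HeegnerKolyvagin, Def. 1.1.8 / Def. 1.2.3 (arXiv p. 5 L144–149, p. 6 L126–131)] -/
def shapiroTameFs (j : ℕ) (n : Finset (HeightOneSpectrum (𝓞 K))) (v : HeightOneSpectrum (𝓞 K)) :
    galoisCohomology ((W.shapiroLevelQuot κ j n).toLocal (Sum.inr v)) 1 →+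
      SingularQuotient (GaloisRep.toLocal v (W.shapiroLevelQuot κ j n)) ⊗[ℤ] Gell v :=
  haveI := fun n ↦ W.finite_shapiroLevelQuotCarrier (K := K) (p := p) κ j n
  tameSlotOn π (fun n ↦ W.shapiroLevelQuot κ j n) P (hP j) n v

/-- Unfolding: the tame slots ARE `tameSlotOn` (any finiteness instance). [cite: Howard2004HeegnerKolyvagin, Def. 1.1.8] -/
theorem shapiroTameFs_eq (j : ℕ) [∀ n, Finite (LevelData.QuotCarrier (IwasawaAlgebra p ⧸ shapiroIdeal p (j + 1))
      ((W.shapiroTower K p κ).ρ j) n)] :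
    W.shapiroTameFs κ π P hP j = tameSlotOn π (fun n ↦ W.shapiroLevelQuot κ j n) P (hP j) :=
  rfl

variable (S : Finset (HeightOneSpectrum (𝓞 K)))
  (hpS : ∀ v : HeightOneSpectrum (𝓞 K), ((p : ℕ) : 𝓞 K) ∈ v.asIdeal → v ∈ S)
  (hbad : ∀ v : HeightOneSpectrum (𝓞 K), v ∉ S → ((p : ℕ) : 𝓞 K) ∉ v.asIdeal → (W.baseChange K).HasGoodReductionAt v)
  (L : Set (HeightOneSpectrum (𝓞 K))) (hL : L ⊆ (W.shapiroTower K p κ).degreeTwoPrimes p) (hLS : ∀ v ∈ L, v ∉ S)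
  (jbar : AlgebraicClosure K →+* ℂ) (cd : ConjugationDatum K)
  (πbar : letI := W.shapiroResidueModule K p
    ∀ j, W.ShapiroLevel K p j →ₗ[IwasawaAlgebra p ⧸ shapiroIdeal p (j + 1)] geomTorsion (W.baseChange K) (p : ℤ))
  (D : ∀ j, DualityDatum p cd ((W.shapiroTower K p κ).ρ j) (IwasawaAlgebra p ⧸ shapiroIdeal p (j + 1)))

set_option synthInstance.maxHeartbeats 80000 in
/-- **`S_Λ` with the TAME finite–singular slots** (`fs := shapiroTameFs π P hP`): the setting on which the cite-only fact of the
sequel is typed. [cite: Howard2004HeegnerKolyvagin, §1.6, Def. 1.1.8, Def. 1.2.3, §2.2–§2.3] [cite: CastellaGrossiLeeSkinner2022, Thm. 4.1.1] -/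
def shapiroSettingTame :
    letI := W.shapiroResidueModule K p
    CoeffTowerSetting p K (IwasawaAlgebra p) (W.ShapiroLevel K p) (fun j ↦ IwasawaAlgebra p ⧸ shapiroIdeal p (j + 1))
      (geomTorsion (W.baseChange K) (p : ℤ))
      (fun j n ↦ LevelData.QuotCarrier (IwasawaAlgebra p ⧸ shapiroIdeal p (j + 1)) ((W.shapiroTower K p κ).ρ j) n) :=
  W.shapiroSetting κ S hpS hbad L hL hLS jbar cd πbar D (W.shapiroTameFs κ π P hP)

set_option synthInstance.maxHeartbeats 80000 in
/-- Unfolding: the tame setting IS `shapiroSetting` at `fs := shapiroTameFs π P hP` (so every `shapiroSetting_*` lemma applies).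
[cite: Howard2004HeegnerKolyvagin, §1.6] -/
theorem shapiroSettingTame_eq :
    letI := W.shapiroResidueModule K p
    W.shapiroSettingTame κ π P hP S hpS hbad L hL hLS jbar cd πbar D =
      W.shapiroSetting κ S hpS hbad L hL hLS jbar cd πbar D (W.shapiroTameFs κ π P hP) :=
  rfl

set_option synthInstance.maxHeartbeats 80000 in
/-- **`FsNatural` for the tame `S_Λ`** (for ANY guard): the slots of consecutive levels are compatible along `𝐓_{j+1}/I_n → 𝐓_j/I_n`
at every `(n, v)` — lit g32's `fsNatural_of_fs_eq_tameSlotOn` with `fsQ_spec` by `rfl`.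
[cite: Howard2004HeegnerKolyvagin, Def. 1.2.3 display (ks relations) and §1.6 (arXiv p. 6 L126–140, p. 11 L45–54)] -/
theorem shapiroSettingTame_fsNatural :
    letI := W.shapiroResidueModule K p
    (W.shapiroSettingTame κ π P hP S hpS hbad L hL hLS jbar cd πbar D).FsNatural := by
  letI := W.shapiroResidueModule K p
  haveI := fun j n ↦ W.finite_shapiroLevelQuotCarrier (K := K) (p := p) κ j n
  exact (W.shapiroSettingTame κ π P hP S hpS hbad L hL hLS jbar cd πbar D).fsNatural_of_fs_eq_tameSlotOn π P hP
    (fun _ ↦ rfl) (fun _ _ _ _ ↦ rfl)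

set_option synthInstance.maxHeartbeats 80000 in
/-- **`FsAdmissible` for the tame `S_Λ` whenever the guard contains the level pairs** `λ ∈ n ∈ 𝓝(𝓛)`: there the slots are
Howard's comparison ISOMORPHISMS on the finite classes, natural in the module (lit g32's `fsAdmissible_of_fs_eq_tameSlotOn`).
[cite: Howard2004HeegnerKolyvagin, Def. 1.1.8 and Def. 1.2.3 (arXiv p. 5 L126–149, p. 7 L1–12)] -/
theorem shapiroSettingTame_fsAdmissible (hPlev : ∀ n ∈ levels L, ∀ v ∈ n, P n v) :
    letI := W.shapiroResidueModule K p
    (W.shapiroSettingTame κ π P hP S hpS hbad L hL hLS jbar cd πbar D).FsAdmissible := by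
  letI := W.shapiroResidueModule K p
  haveI := fun j n ↦ W.finite_shapiroLevelQuotCarrier (K := K) (p := p) κ j n
  exact (W.shapiroSettingTame κ π P hP S hpS hbad L hL hLS jbar cd πbar D).fsAdmissible_of_fs_eq_tameSlotOn π P hP
    (fun _ ↦ rfl) (fun _ n hn v hv ↦ hPlev n hn v hv)

set_option synthInstance.maxHeartbeats 80000 in
include S hpS hbad hL hLS in
/-- **The canonical guard is certified**: at `λ ∈ n ∈ 𝓝(𝓛)` the tame hypotheses hold for `𝐓_j/I_n 𝐓_j` at EVERY level `j`
(`𝐓_j` free over `Λ/(ω_{j+1}, p^{j+1})`: lit g32's `tameHyp_of_mem_levels_of_free`, read on the canonical presentation of the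
level triple `(𝐓_j, 𝓕_Λ, 𝓛)`) — so `P n v := n ∈ 𝓝(𝓛) ∧ v ∈ n` is an admissible guard (`hP`) containing the level pairs.
[cite: Howard2004HeegnerKolyvagin, Def. 1.1.8, Def. 1.2.1–1.2.3 and H.0 (arXiv pp. 5–7)] -/
theorem shapiroTameHyp_of_mem_levels (j : ℕ) (n : Finset (HeightOneSpectrum (𝓞 K))) (v : HeightOneSpectrum (𝓞 K))
    (h : n ∈ levels L ∧ v ∈ n) : TameHyp (fun n ↦ W.shapiroLevelQuot κ j n) n v := by
  haveI := W.free_shapiroLevel (K := K) (p := p) j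
  exact tameHyp_of_mem_levels_of_free
    (LevelData.canonical (IwasawaAlgebra p ⧸ shapiroIdeal p (j + 1)) ((W.shapiroTower K p κ).ρ j)
      (W.isScalarLinear_shapiroTower_coeff κ j) (W.shapiroTowerTriple κ S hpS hbad L hL hLS j) (fun _ _ ↦ 0))
    (W.shapiroTowerTriple_primes κ S hpS hbad L hL hLS j) n v h

end Tame

end WeierstrassCurve

end
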